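import Mathlib.Analysis.Real.Pi.Bounds
import Mathlib.Analysis.Convex.SpecificFunctions.Deriv
import Mathlib.Analysis.SpecialFunctions.Trigonometric.Bounds
import Literature.MathematicalPhysics.QuantumFieldTheory.Balaban1983to89.Beta.MonotoneScales

/-!
# `Balaban1983to89.Beta.NearAliasFloor` — an `n`-UNIFORM PRODUCT-FORM MINORANT for `y = Δ₀φ^{(1.62)}`:
# the `2^d` NEAR ALIASES, Jordan's inequality kept as a FUNCTION, and the reduction of the floor lever to TWO
# ONE-DIMENSIONAL inequalities

β-PERT ACCELERATION sub-cell, asymptotic lane asym1 (gen 6; v1.1 = v1 + §7, append-only; v1.2 = DOCFIX of two float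
roundings, statements byte-unchanged).  HONEST FRAMING (cell contract, verbatim):
discharging `BetaPertH` makes Bałaban's UV stability UNCONDITIONAL — a real constructive-QFT result; it is
NOT the continuum limit and NOT the Clay problem.  THIS FILE is elementary bookkeeping about the printed U = 1
alias sum (1.62) of [B5]; it is NOT a wall binder, NOT `β̄_k → b₀ ln L`, and touches nothing non-abelian.

## What is here

The tree's lower bound «γ₀ ≤ Δ₀φ_μ» (`B5Bounds167Lattice.Delta0_phi162_lower`, `γ₀ = (4/π²)^{d+2}` = `gam0 d`)
keeps the `l = 0` alias and replaces every Jordan factor `sinc²` by its minimum `4/π²`.  Here (all `n ≥ 1`, all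
`p′ = s ≠ 0` in the Brillouin zone, every direction `λ`; `q := 4/π²`, `σ(x) := 4sin²(x/2)/x²` (`σ(0) = 1`),
`τ(x) := 4sin²(x/2)/(2π − |x|)²`):

* §1 the one-dimensional functions `σ, τ, g := σ + τ²/q, h := σ² + τ³/q` and their elementary ranges
  (`q ≤ σ ≤ 1`, `0 ≤ τ ≤ q`, hence `q ≤ g`, `q² ≤ h`);
* §2 the NEAR ALIASES `l_ν ∈ {0, −sgn s_ν}`: `S_ξ(s_ν + 2πl_ν) ≤ u_ν²` with `u_ν = |s_ν|` resp. `2π − |s_ν|`, uniformly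
  in `n` (`|sin| ≤ |·|` and `2πn`-periodicity), so the `|u|²`-factors are `≥ σ(s_ν)` resp. `≥ τ(s_ν)`;
* §3 **`Mfloor_le_xIn`: `y_λ^{(n)}(s) ≥ M_λ(s) := q · Π_{ν ≠ λ} g(s_ν) · h(s_λ)` for every `n ≥ 1`** — keep the `2^d`
  near aliases, bound `Δ₀(s)/Δ(s+2πl)` by the MEDIANT `≥ min_ν(σ or τ) ≥ q·Π_{far ν}(τ_ν/q)`, and factorise the sum
  over subsets (`Fintype.prod_add`).  At the corner `s = (π,…,π)` this is `2^d·q^{d+2} = 2^d·γ₀` (`Mfloor_corner`),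
  the full near-alias sum; the tree's `γ₀` is recovered from `g ≥ q`, `h ≥ q²` (`gam0_le_Mfloor`);
* §4 **THE SOCKET `xIn_floor_of_oneDim`**: two ONE-DIMENSIONAL inequalities `g₀ ≤ g`, `h₀ ≤ h` on `[−π,π]` give the
  `n`-UNIFORM floor `q·g₀^{d−1}·h₀ ≤ y_λ^{(n)}(s)` for all `n, s, λ` — hence (by `MonotoneScales`) for the limit
  `y_∞ = ⨅_m y^{(L^m)}` too (`iInf_xIn_floor_of_oneDim`): lever (1) of the asym1 constant ledger (ASYM-beta §3.7)
  reduced to two 1-D certifications (float minima `g_min = 0.732668…` at `|x| = 2.5014`, `h_min = 0.319386…` at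
  `|x| = 2.9636`, i.e. `11.5·γ₀` at `d = 4` — so valid 1-D certification TARGETS are the truncations `g₀ ≤ 0.7326`,
  `h₀ ≤ 0.3193`, never the roundings (v1.2 DOCFIX, cap-ref R-asym-3); the truth for `y_∞` itself is `18.2·γ₀`);
* §5 **UNCONDITIONAL 1-D BOUNDS `g ≥ 0.71`, `h ≥ 0.3` (`gh_lower`)**, kernel-checked: `σ` is antitone on `[0,π]`
  (chord of the concave `sin`, `strictConcaveOn_sin_Icc`), `τ` is monotone, the POLYNOMIAL minorant
  `sin(y/2) ≥ 1 − (π−y)²/8` (`Real.one_sub_sq_div_two_le_cos`) and `3.141592 < π < 3.1416` (`Real.pi_gt_d6`,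
  `Real.pi_lt_d4`) turn each of 1 + 20 pieces of `[0,π]` into a RATIONAL evaluation closed by `norm_num`;
* §6 **`Cfloor_le_xIn`: the unconditional `n`-uniform floor `C_floor(d) := q·0.71^{d−1}·0.3 ≤ Δ₀φ_λ^{(n)}(s)`**,
  `Cfloor_le_iInf_xIn` (tower limit), `xIn_mem_box'` (`C_floor ≤ y ≤ 1`), and at `d = 4`:
  `0.0435 ≤ C_floor(4)` (`Cfloor_four_ge`), `9.8·γ₀ ≤ C_floor(4)` (`gam0_four_le`) — the tree's `γ₀ = 0.00443`
  improved ×9.8, uniformly in the averaging scale, by elementary means;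
* §7 (v1.1) **THE CHAIN ABOVE THE CERTIFIED FLOOR**: `_Cfloor` twins of every tree-floor statement of
  `Beta.LogCloseRate` / `Beta.MonotoneScales` — box variable (`xIn_relClose_Cfloor`), `D_k` in Loewner / entry /
  form grade (`qform_DeltaKfib_relClose_Cfloor`, `qform_DeltaKfib_sandwich_Cfloor`, `DeltaKfib_rate_Cfloor`,
  `qform_DeltaKfib_rate_Cfloor`), the (1.66) weight (`w166_relClose_Cfloor`), the U(1) effective action incl.
  King's (3.92)/(3.93) shapes (`formDk_relClose_Cfloor`, `formDk_sandwich_Cfloor`, `abs_formDk_sub_le_rel_Cfloor`,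
  `log_formDk_sub_bounds_Cfloor`) and the `η → 0` limits along `N = L^k` (`DeltaKfib_limit_Cfloor`,
  `w166_limit_rel_Cfloor`, `formDk_limit_rel_Cfloor`) — the floor binder discharged for all levels at once; at
  `d = 4`: relative constant `4d·C_φ/C_floor ≤ 426` (`relConst_four_le`; tree floor 4173), log-rate `≤ 1278`
  (`logConst_four_le`; 1.25·10⁴), `D_k` entry constant `≤ 3.13·10⁵` (`entryConst_four_le`; 3.0·10⁷).

CONSUMERS (all take a floor `y ≤ xIn` as a binder; discharged by `Cfloor_le_xIn` in §7 with `×9.8` better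
constants than `gam0`): `LogCloseRate.qform_DeltaKfib_relClose`, `MonotoneScales.qform_DeltaKfib_sandwich`,
`MonotoneScales.floor_transfer` / `floor_of_iInf_floor`, the `_gam0` corollaries of both files.

## Sources.  [B5] = [Balaban1984PropagatorsI] (1.62) p. 28 with «0 < γ₀ ≤ Δ₀φ_μ ≤ γ₁» (uniform bounds only);
[King1986] (4.12) p. 671 (scalar analogue).  No near-alias / product-form floor for (1.62) is printed there;
presearch (corpus fts+vec, galaxy) found none.  Tags: [folklore] = elementary consequence of printed formulas.
Float evidence (NOT used): `HOME/b2b-balaban-beta-asym1-g6/FLOOR-minorant.md`, `floor_scan.py`.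
-/

noncomputable section

namespace Literature.MathematicalPhysics.QuantumFieldTheory.Balaban1983to89.Beta.NearAliasFloor

open scoped BigOperators
open Finset Real
open Literature.MathematicalPhysics.QuantumFieldTheory.Balaban1983to89.B4Strip
open Literature.MathematicalPhysics.QuantumFieldTheory.Balaban1983to89.B5Prop11Leaves
open Literature.MathematicalPhysics.QuantumFieldTheory.Balaban1983to89.B5Bounds167Lattice
open Literature.MathematicalPhysics.QuantumFieldTheory.Balaban1983to89.T4GaugeActionRate
open Literature.MathematicalPhysics.QuantumFieldTheory.Balaban1983to89.B5ActionRate166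

variable {d : ℕ}

/-! ## §1 The one-dimensional functions -/

section OneDim

/-- `q = 4/π²` (Jordan's constant). [folklore] -/
def qJ : ℝ := 4 / Real.pi ^ 2

/-- `q > 0`. [folklore] -/
theorem qJ_pos : 0 < qJ := by unfold qJ; positivity

/-- `q ≤ 1` (`π > 3`). [folklore] -/
theorem qJ_le_one : qJ ≤ 1 := by
  unfold qJ
  have h := Real.pi_gt_three
  rw [div_le_one (by positivity)]; nlinarith

/-- `σ(x) = 4sin²(x/2)/x²` (`= sinc²(x/2)`, value `1` at `0`): the `l = 0` Jordan factor KEPT AS A FUNCTION. [folklore] -/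
def sig0 (x : ℝ) : ℝ := if x = 0 then 1 else S1r x / x ^ 2

/-- `τ(x) = 4sin²(x/2)/(2π − |x|)²`: the factor of the NEAREST NONZERO alias `l = −sgn x`. [folklore] -/
def tauF (x : ℝ) : ℝ := S1r x / (2 * Real.pi - |x|) ^ 2

/-- `g = σ + τ²/q` (the factor of a direction `ν ≠ λ`). [folklore] -/
def gFun (x : ℝ) : ℝ := sig0 x + tauF x ^ 2 / qJ

/-- `h = σ² + τ³/q` (the factor of the direction `λ` itself). [folklore] -/
def hFun (x : ℝ) : ℝ := sig0 x ^ 2 + tauF x ^ 3 / qJ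

/-- Jordan: `q ≤ σ(x)` on `|x| ≤ π`. [folklore] -/
theorem qJ_le_sig0 (x : ℝ) (hx : |x| ≤ Real.pi) : qJ ≤ sig0 x := by
  unfold sig0 qJ
  split_ifs with h0
  · have h := Real.pi_gt_three
    rw [div_le_one (by positivity)]; nlinarith
  · have hx2 : 0 < x ^ 2 := by positivity
    rw [le_div_iff₀ hx2]
    have h := S1r_ge x hx
    calc 4 / Real.pi ^ 2 * x ^ 2 = 4 * x ^ 2 / Real.pi ^ 2 := by ring
      _ ≤ S1r x := h

/-- `σ > 0` on `[−π,π]`. [folklore] -/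
theorem sig0_pos (x : ℝ) (hx : |x| ≤ Real.pi) : 0 < sig0 x := lt_of_lt_of_le qJ_pos (qJ_le_sig0 x hx)

/-- `σ ≥ 0`. [folklore] -/
theorem sig0_nonneg (x : ℝ) : 0 ≤ sig0 x := by
  unfold sig0; split_ifs
  · exact zero_le_one
  · exact div_nonneg (S1r_nonneg x) (sq_nonneg x)

/-- `2π − |x| > 0` on `[−π,π]`. [folklore] -/
theorem two_pi_sub_abs_pos (x : ℝ) (hx : |x| ≤ Real.pi) : 0 < 2 * Real.pi - |x| := by
  have h := Real.pi_pos; linarith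

/-- `τ ≥ 0`. [folklore] -/
theorem tauF_nonneg (x : ℝ) : 0 ≤ tauF x := div_nonneg (S1r_nonneg x) (sq_nonneg _)

/-- `τ ≤ q` on `|x| ≤ π` (`4sin² ≤ 4`, `(2π − |x|)² ≥ π²`). [folklore] -/
theorem tauF_le_qJ (x : ℝ) (hx : |x| ≤ Real.pi) : tauF x ≤ qJ := by
  unfold tauF qJ
  have hpi := Real.pi_pos
  have h1 : S1r x ≤ 4 := S1r_le_four x
  have h2 : Real.pi ^ 2 ≤ (2 * Real.pi - |x|) ^ 2 := by nlinarith [abs_nonneg x]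
  calc S1r x / (2 * Real.pi - |x|) ^ 2 ≤ 4 / (2 * Real.pi - |x|) ^ 2 :=
        div_le_div_of_nonneg_right h1 (sq_nonneg _)
    _ ≤ 4 / Real.pi ^ 2 := div_le_div_of_nonneg_left (by norm_num) (by positivity) h2

/-- `τ(x)·(2π − |x|)² = 4sin²(x/2) = S₁(x)`. [folklore] -/
theorem tauF_mul_sq (x : ℝ) (hx : |x| ≤ Real.pi) : tauF x * (2 * Real.pi - |x|) ^ 2 = S1r x := by
  unfold tauF
  have h := two_pi_sub_abs_pos x hx
  field_simp

/-- `σ(x)·x² = S₁(x)`. [folklore] -/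
theorem sig0_mul_sq (x : ℝ) : sig0 x * x ^ 2 = S1r x := by
  unfold sig0; split_ifs with h0
  · subst h0; simp [S1r]
  · field_simp

/-- `q ≤ g` on `[−π,π]`. [folklore] -/
theorem qJ_le_gFun (x : ℝ) (hx : |x| ≤ Real.pi) : qJ ≤ gFun x := by
  unfold gFun
  have h1 := qJ_le_sig0 x hx
  have h2 : 0 ≤ tauF x ^ 2 / qJ := div_nonneg (sq_nonneg _) qJ_pos.le
  linarith

/-- `q² ≤ h` on `[−π,π]`. [folklore] -/
theorem qJ_sq_le_hFun (x : ℝ) (hx : |x| ≤ Real.pi) : qJ ^ 2 ≤ hFun x := by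
  unfold hFun
  have h1 := qJ_le_sig0 x hx
  have h2 : 0 ≤ tauF x ^ 3 / qJ := div_nonneg (pow_nonneg (tauF_nonneg x) 3) qJ_pos.le
  have h3 : qJ ^ 2 ≤ sig0 x ^ 2 := pow_le_pow_left₀ qJ_pos.le h1 2
  linarith

/-- `g > 0` on `[−π,π]`. [folklore] -/
theorem gFun_pos (x : ℝ) (hx : |x| ≤ Real.pi) : 0 < gFun x := lt_of_lt_of_le qJ_pos (qJ_le_gFun x hx)

/-- `h > 0` on `[−π,π]`. [folklore] -/
theorem hFun_pos (x : ℝ) (hx : |x| ≤ Real.pi) : 0 < hFun x :=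
  lt_of_lt_of_le (pow_pos qJ_pos 2) (qJ_sq_le_hFun x hx)

end OneDim

/-! ## §2 The near aliases, uniformly in `n` -/

section Near

/-- `S_ξ` is `2πn`-periodic. [folklore] -/
theorem Sxir_add_period (n : ℕ) (hn : 1 ≤ n) (y : ℝ) : Sxir n (y + 2 * Real.pi * n) = Sxir n y := by
  unfold Sxir
  have hn' : (n : ℝ) ≠ 0 := by
    have : (1 : ℝ) ≤ n := by exact_mod_cast hn
    linarith
  have e : (y + 2 * Real.pi * n) / n = y / n + 2 * Real.pi := by field_simp
  rw [e, Real.cos_add_two_pi]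

/-- the index of the NEAREST NONZERO alias of `x ∈ [−π,π]`: `l = −1 ≡ n − 1` for `x ≥ 0`, `l = +1` for `x < 0`.
[folklore] -/
def farIdx (n : ℕ) (hn : 2 ≤ n) (x : ℝ) : Fin n :=
  if 0 ≤ x then ⟨n - 1, by omega⟩ else ⟨1, by omega⟩

/-- the near nonzero alias is nonzero (as a natural number). [folklore] -/
theorem farIdx_val_ne_zero (n : ℕ) (hn : 2 ≤ n) (x : ℝ) : ((farIdx n hn x : Fin n) : ℕ) ≠ 0 := by
  unfold farIdx; split_ifs
  · simp only [ne_eq]; omega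
  · simp

/-- `1 ≤ l` for the near nonzero alias. [folklore] -/
theorem one_le_farIdx (n : ℕ) (hn : 2 ≤ n) (x : ℝ) : 1 ≤ ((farIdx n hn x : Fin n) : ℕ) :=
  Nat.one_le_iff_ne_zero.mpr (farIdx_val_ne_zero n hn x)

/-- **the near alias has `S_ξ(x + 2πl) ≤ (2π − |x|)²`, uniformly in `n`**. [folklore] -/
theorem Sxir_far_le (n : ℕ) (hn : 2 ≤ n) (x : ℝ) :
    Sxir n (x + 2 * Real.pi * ((farIdx n hn x : Fin n) : ℕ)) ≤ (2 * Real.pi - |x|) ^ 2 := by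
  unfold farIdx
  split_ifs with h0
  · -- `l = n − 1`: `x + 2π(n−1) = (x − 2π) + 2πn`
    have hcast : (((⟨n - 1, by omega⟩ : Fin n) : ℕ) : ℝ) = (n : ℝ) - 1 := by
      simp [Nat.cast_sub (by omega : 1 ≤ n)]
    rw [hcast]
    have e : x + 2 * Real.pi * ((n : ℝ) - 1) = (x - 2 * Real.pi) + 2 * Real.pi * n := by ring
    rw [e, Sxir_add_period n (by omega)]
    calc Sxir n (x - 2 * Real.pi) ≤ (x - 2 * Real.pi) ^ 2 := Sxir_le n _
      _ = (2 * Real.pi - |x|) ^ 2 := by rw [abs_of_nonneg h0]; ring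
  · have h0 : x < 0 := lt_of_not_ge h0
    have hcast : (((⟨1, by omega⟩ : Fin n) : ℕ) : ℝ) = 1 := by simp
    rw [hcast, mul_one]
    calc Sxir n (x + 2 * Real.pi) ≤ (x + 2 * Real.pi) ^ 2 := Sxir_le n _
      _ = (2 * Real.pi - |x|) ^ 2 := by rw [abs_of_neg h0]; ring

/-- … and `S_ξ(x + 2πl) ≥ 4 > 0` there. [folklore] -/
theorem Sxir_far_pos (n : ℕ) (hn : 2 ≤ n) (x : ℝ) (hx : |x| ≤ Real.pi) :
    0 < Sxir n (x + 2 * Real.pi * ((farIdx n hn x : Fin n) : ℕ)) := by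
  have h1 := one_le_farIdx n hn x
  have h2 : ((farIdx n hn x : Fin n) : ℕ) + 1 ≤ n := (farIdx n hn x).isLt
  have h := Sxir_shift_ge_four n _ h1 h2 x hx
  linarith

/-- the `l = 0` factor dominates `σ`: `σ(x) ≤ ρ_n(x) = uFactorr n 0 x` (`S_ξ(x) ≤ x²`). [folklore] -/
theorem sig0_le_uFactorr_zero (n : ℕ) (hn : 1 ≤ n) (x : ℝ) (hx : |x| ≤ Real.pi) :
    sig0 x ≤ uFactorr n 0 x := by
  unfold sig0 uFactorr
  simp only [if_true]
  by_cases h0 : x = 0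
  · simp [h0]
  · simp only [h0, if_false]
    exact div_le_div_of_nonneg_left (S1r_nonneg x) (Sxir_pos n hn x h0 hx) (Sxir_le n x)

/-- the near-alias factor dominates `τ`: `τ(x) ≤ uFactorr n l x` at `l = farIdx`. [folklore] -/
theorem tauF_le_uFactorr_far (n : ℕ) (hn : 2 ≤ n) (x : ℝ) (hx : |x| ≤ Real.pi) :
    tauF x ≤ uFactorr n ((farIdx n hn x : Fin n) : ℕ) x := by
  unfold uFactorr
  rw [if_neg (farIdx_val_ne_zero n hn x)]
  unfold tauF
  exact div_le_div_of_nonneg_left (S1r_nonneg x) (Sxir_far_pos n hn x hx) (Sxir_far_le n hn x)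

end Near

/-! ## §3 The product-form minorant -/

section Floor

variable (n : ℕ) [NeZero n] (hn : 2 ≤ n) (s : Fin d → ℝ)

/-- the alias selected by a set `K` of "far" directions: `l_ν = farIdx` on `K`, `0` off `K`. [folklore] -/
def kSel (K : Finset (Fin d)) : Fin d → Fin n :=
  fun ν => if ν ∈ K then farIdx n hn (s ν) else 0

/-- the one-dimensional factor selected by `K` in direction `ν`: `τ(s_ν)` on `K`, `σ(s_ν)` off `K`. [folklore] -/
def cSel (K : Finset (Fin d)) (ν : Fin d) : ℝ := if ν ∈ K then tauF (s ν) else sig0 (s ν)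

/-- the mediant constant of `K`: `m_K = q · Π_{ν ∈ K} (τ(s_ν)/q)`. [folklore] -/
def mSel (K : Finset (Fin d)) : ℝ := qJ * ∏ ν ∈ K, tauF (s ν) / qJ

variable {n hn s}

/-- `kSel` on `K`. [folklore] -/
theorem kSel_apply_of_mem {K : Finset (Fin d)} {ν : Fin d} (h : ν ∈ K) :
    kSel n hn s K ν = farIdx n hn (s ν) := by simp [kSel, h]

/-- `kSel` off `K`. [folklore] -/
theorem kSel_val_of_not_mem {K : Finset (Fin d)} {ν : Fin d} (h : ν ∉ K) :
    ((kSel n hn s K ν : Fin n) : ℕ) = 0 := by simp [kSel, h]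

/-- `(kSel K)_ν ≠ 0 ↔ ν ∈ K`. [folklore] -/
theorem kSel_val_ne_zero_iff (K : Finset (Fin d)) (ν : Fin d) :
    ((kSel n hn s K ν : Fin n) : ℕ) ≠ 0 ↔ ν ∈ K := by
  by_cases h : ν ∈ K
  · simp only [kSel_apply_of_mem h, h, iff_true]; exact farIdx_val_ne_zero n hn _
  · simp [kSel_val_of_not_mem h, h]

/-- `K ↦ kSel K` is injective. [folklore] -/
theorem kSel_injective : Function.Injective (kSel n hn s) := by
  intro K K' hKK
  ext ν
  have h1 := kSel_val_ne_zero_iff (n := n) (hn := hn) (s := s) K ν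
  have h2 := kSel_val_ne_zero_iff (n := n) (hn := hn) (s := s) K' ν
  rw [← h1, ← h2, hKK]

/-- `c_ν ≥ 0`. [folklore] -/
theorem cSel_nonneg (K : Finset (Fin d)) (ν : Fin d) : 0 ≤ cSel s K ν := by
  unfold cSel; split_ifs
  · exact tauF_nonneg _
  · exact sig0_nonneg _

/-- (a) each selected `|u|²`-factor dominates the selected one-dimensional function. [folklore] -/
theorem cSel_le_uFactorr (hs : ∀ ν, |s ν| ≤ Real.pi) (K : Finset (Fin d)) (ν : Fin d) :
    cSel s K ν ≤ uFactorr n ((kSel n hn s K ν : Fin n) : ℕ) (s ν) := by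
  unfold cSel
  by_cases h : ν ∈ K
  · rw [if_pos h, kSel_apply_of_mem h]; exact tauF_le_uFactorr_far n hn (s ν) (hs ν)
  · rw [if_neg h, kSel_val_of_not_mem h]; exact sig0_le_uFactorr_zero n (by omega) (s ν) (hs ν)

/-- (b) `Π_ν c_ν ≤ |u(s + 2πl_K)|² = Ur`. [folklore] -/
theorem prod_cSel_le_Ur (hs : ∀ ν, |s ν| ≤ Real.pi) (K : Finset (Fin d)) :
    ∏ ν, cSel s K ν ≤ Ur n (kSel n hn s K) s := by
  unfold Ur
  exact Finset.prod_le_prod (fun ν _ => cSel_nonneg K ν) fun ν _ => cSel_le_uFactorr hs K ν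

/-- `m_K ≥ 0`. [folklore] -/
theorem mSel_nonneg (K : Finset (Fin d)) : 0 ≤ mSel s K :=
  mul_nonneg qJ_pos.le (Finset.prod_nonneg fun _ _ => div_nonneg (tauF_nonneg _) qJ_pos.le)

/-- `m_K ≤ q`. [folklore] -/
theorem mSel_le_qJ (hs : ∀ ν, |s ν| ≤ Real.pi) (K : Finset (Fin d)) : mSel s K ≤ qJ := by
  unfold mSel
  have h : ∏ ν ∈ K, tauF (s ν) / qJ ≤ 1 :=
    Finset.prod_le_one (fun ν _ => div_nonneg (tauF_nonneg _) qJ_pos.le)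
      fun ν _ => (div_le_one qJ_pos).mpr (tauF_le_qJ (s ν) (hs ν))
  calc qJ * ∏ ν ∈ K, tauF (s ν) / qJ ≤ qJ * 1 := mul_le_mul_of_nonneg_left h qJ_pos.le
    _ = qJ := mul_one _

/-- `m_K ≤ τ(s_ν)` for `ν ∈ K`. [folklore] -/
theorem mSel_le_tauF (hs : ∀ ν, |s ν| ≤ Real.pi) {K : Finset (Fin d)} {ν : Fin d} (h : ν ∈ K) :
    mSel s K ≤ tauF (s ν) := by
  unfold mSel
  rw [← Finset.mul_prod_erase K (fun μ => tauF (s μ) / qJ) h]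
  have h1 : ∏ μ ∈ K.erase ν, tauF (s μ) / qJ ≤ 1 :=
    Finset.prod_le_one (fun μ _ => div_nonneg (tauF_nonneg _) qJ_pos.le)
      fun μ _ => (div_le_one qJ_pos).mpr (tauF_le_qJ (s μ) (hs μ))
  have h2 : 0 ≤ tauF (s ν) / qJ := div_nonneg (tauF_nonneg _) qJ_pos.le
  have hq := qJ_pos
  calc qJ * (tauF (s ν) / qJ * ∏ μ ∈ K.erase ν, tauF (s μ) / qJ)
      ≤ qJ * (tauF (s ν) / qJ * 1) := by
        apply mul_le_mul_of_nonneg_left _ hq.le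
        exact mul_le_mul_of_nonneg_left h1 h2
    _ = tauF (s ν) := by field_simp

/-- (c) THE MEDIANT STEP, termwise: `m_K · S_ξ(s_ν + 2πl_ν) ≤ S₁(s_ν)` for every `ν`. [folklore] -/
theorem mSel_mul_Sxir_le (hs : ∀ ν, |s ν| ≤ Real.pi) (K : Finset (Fin d)) (ν : Fin d) :
    mSel s K * Sxir n (s ν + 2 * Real.pi * ((kSel n hn s K ν : Fin n) : ℕ)) ≤ S1r (s ν) := by
  have hm0 := mSel_nonneg (s := s) K
  by_cases h : ν ∈ K
  · rw [kSel_apply_of_mem h]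
    have h1 := Sxir_far_le n hn (s ν)
    have h2 := mSel_le_tauF hs h
    calc mSel s K * Sxir n (s ν + 2 * Real.pi * ((farIdx n hn (s ν) : Fin n) : ℕ))
        ≤ tauF (s ν) * (2 * Real.pi - |s ν|) ^ 2 :=
          mul_le_mul h2 h1 (Sxir_nonneg _ _) (tauF_nonneg _)
      _ = S1r (s ν) := tauF_mul_sq (s ν) (hs ν)
  · rw [kSel_val_of_not_mem h]
    simp only [Nat.cast_zero, mul_zero, add_zero]
    have h1 := Sxir_le n (s ν)
    have h2 := mSel_le_qJ hs K
    have h3 := S1r_ge (s ν) (hs ν)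
    calc mSel s K * Sxir n (s ν) ≤ qJ * (s ν) ^ 2 := mul_le_mul h2 h1 (Sxir_nonneg _ _) qJ_pos.le
      _ = 4 * (s ν) ^ 2 / Real.pi ^ 2 := by unfold qJ; ring
      _ ≤ S1r (s ν) := h3

/-- (c) summed: `m_K · Δ(s + 2πl_K) ≤ Δ₀(s)`. [folklore] -/
theorem mSel_mul_DeltaXir_le (hs : ∀ ν, |s ν| ≤ Real.pi) (K : Finset (Fin d)) :
    mSel s K * DeltaXir n 0 (shiftr n (kSel n hn s K) s) ≤ Delta1r 0 s := by
  unfold DeltaXir Delta1r shiftr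
  rw [add_zero, add_zero, Finset.mul_sum]
  exact Finset.sum_le_sum fun ν _ => mSel_mul_Sxir_le hs K ν

/-- `Δ(s + 2πl) > 0` for every alias on the punctured zone. [folklore] -/
theorem DeltaXir_shift_pos (hn1 : 1 ≤ n) (hs : ∀ ν, |s ν| ≤ Real.pi) (ν₀ : Fin d) (hν₀ : s ν₀ ≠ 0)
    (k : Fin d → Fin n) : 0 < DeltaXir n 0 (shiftr n k s) := by
  by_cases hk : k = fun _ => 0
  · rw [hk, shiftr_zero]; exact DeltaXir_pos n hn1 s hs ν₀ hν₀
  · have h := DeltaXir_shift_ge_four n k hk s hs; linarith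

/-- (a)–(c) combined: the `K`-th near-alias term of `Δ₀φ_λ` dominates `(Π_ν c_ν)·c_λ·m_K`. [folklore] -/
theorem term_ge (hs : ∀ ν, |s ν| ≤ Real.pi) (ν₀ : Fin d) (hν₀ : s ν₀ ≠ 0) (lam : Fin d) (K : Finset (Fin d)) :
    (∏ ν, cSel s K ν) * cSel s K lam * mSel s K
      ≤ Ur n (kSel n hn s K) s * uFactorr n ((kSel n hn s K lam : Fin n) : ℕ) (s lam)
          * (Delta1r 0 s / DeltaXir n 0 (shiftr n (kSel n hn s K) s)) := by
  have hD := DeltaXir_shift_pos (n := n) (by omega) hs ν₀ hν₀ (kSel n hn s K)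
  have h1 := prod_cSel_le_Ur (n := n) (hn := hn) hs K
  have h2 := cSel_le_uFactorr (n := n) (hn := hn) hs K lam
  have h3 : mSel s K ≤ Delta1r 0 s / DeltaXir n 0 (shiftr n (kSel n hn s K) s) := by
    rw [le_div_iff₀ hD]; exact mSel_mul_DeltaXir_le hs K
  have hc0 : 0 ≤ ∏ ν, cSel s K ν := Finset.prod_nonneg fun ν _ => cSel_nonneg K ν
  have hcl : 0 ≤ cSel s K lam := cSel_nonneg K lam
  exact mul_le_mul (mul_le_mul h1 h2 hcl (Ur_nonneg _ _ _)) h3 (mSel_nonneg K)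
    (mul_nonneg (Ur_nonneg _ _ _) (uFactorr_nonneg _ _ _))

/-- the `K`-th summand of the factorised product: `a_ν = σ` (resp. `σ²` at `λ`) off `K`, `b_ν = τ²/q`
(resp. `τ³/q` at `λ`) on `K`. [folklore] -/
def eSel (s : Fin d → ℝ) (lam : Fin d) (K : Finset (Fin d)) (ν : Fin d) : ℝ :=
  if ν ∈ K then (if ν = lam then tauF (s ν) ^ 3 / qJ else tauF (s ν) ^ 2 / qJ)
  else (if ν = lam then sig0 (s ν) ^ 2 else sig0 (s ν))

/-- (d) pointwise bookkeeping: `(Π_ν c_ν)·c_λ·m_K = q·Π_ν e_ν(K)`. [folklore] -/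
theorem term_eq_prod_eSel (lam : Fin d) (K : Finset (Fin d)) :
    (∏ ν, cSel s K ν) * cSel s K lam * mSel s K = qJ * ∏ ν, eSel s lam K ν := by
  have hq : qJ ≠ 0 := qJ_pos.ne'
  unfold mSel
  -- write `c_λ` and `Π_{ν∈K}` as products over `univ`
  have e1 : cSel s K lam = ∏ ν, (if ν = lam then cSel s K ν else 1) := by
    rw [Finset.prod_ite_eq' Finset.univ lam (fun ν => cSel s K ν)]; simp
  have e2 : ∏ ν ∈ K, tauF (s ν) / qJ = ∏ ν, (if ν ∈ K then tauF (s ν) / qJ else 1) := by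
    rw [← Finset.prod_filter]; congr 1; ext ν; simp
  rw [e1, e2]
  calc (∏ ν, cSel s K ν) * (∏ ν, if ν = lam then cSel s K ν else 1)
        * (qJ * ∏ ν, if ν ∈ K then tauF (s ν) / qJ else 1)
      = qJ * ∏ ν, (cSel s K ν * (if ν = lam then cSel s K ν else 1)
          * (if ν ∈ K then tauF (s ν) / qJ else 1)) := by
        rw [Finset.prod_mul_distrib, Finset.prod_mul_distrib]; ring
    _ = qJ * ∏ ν, eSel s lam K ν := by
        congr 1
        refine Finset.prod_congr rfl fun ν _ => ?_
        by_cases hK : ν ∈ K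
        · by_cases hl : ν = lam
          · subst hl
            simp only [cSel, eSel, hK, if_true]; ring
          · simp only [cSel, eSel, hK, hl, if_true, if_false]; ring
        · by_cases hl : ν = lam
          · subst hl
            simp only [cSel, eSel, hK, if_true, if_false]; ring
          · simp only [cSel, eSel, hK, hl, if_false]; ring

/-- the product-form minorant `M_λ(s) = q · Π_{ν ≠ λ} g(s_ν) · h(s_λ)`. [folklore] -/
def Mfloor (s : Fin d → ℝ) (lam : Fin d) : ℝ :=
  qJ * ((∏ ν ∈ Finset.univ.erase lam, gFun (s ν)) * hFun (s lam))

/-- (e) the subset sum factorises: `Σ_K q·Π_ν e_ν(K) = q·Π_{ν≠λ} g(s_ν)·h(s_λ) = M_λ(s)` (`Fintype.prod_add`). [folklore] -/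
theorem sum_prod_eSel (lam : Fin d) :
    ∑ K : Finset (Fin d), qJ * ∏ ν, eSel s lam K ν = Mfloor s lam := by
  unfold Mfloor
  set a : Fin d → ℝ := fun ν => if ν = lam then sig0 (s ν) ^ 2 else sig0 (s ν) with ha
  set b : Fin d → ℝ := fun ν => if ν = lam then tauF (s ν) ^ 3 / qJ else tauF (s ν) ^ 2 / qJ with hb
  have hK : ∀ K : Finset (Fin d), ∏ ν, eSel s lam K ν = (∏ ν ∈ K, b ν) * ∏ ν ∈ Kᶜ, a ν := by
    intro K
    rw [← Fintype.prod_ite_mem K b, ← Fintype.prod_ite_mem Kᶜ a, ← Finset.prod_mul_distrib]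
    refine Finset.prod_congr rfl fun ν _ => ?_
    by_cases h : ν ∈ K
    · have h' : ν ∉ Kᶜ := by simp [h]
      simp only [eSel, h, h', if_true, if_false, mul_one, hb]
    · have h' : ν ∈ Kᶜ := by simp [h]
      simp only [eSel, h, h', if_true, if_false, one_mul, ha]
  rw [← Finset.mul_sum]
  congr 1
  rw [Finset.sum_congr rfl fun K _ => hK K, ← Fintype.prod_add b a,
    ← Finset.prod_erase_mul Finset.univ (fun ν => b ν + a ν) (Finset.mem_univ lam)]
  congr 1
  · refine Finset.prod_congr rfl fun ν hν => ?_
    have hne : ν ≠ lam := Finset.ne_of_mem_erase hν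
    simp only [ha, hb, hne, if_false, gFun]; ring
  · simp only [ha, hb, if_true, hFun]; ring

/-- **THE NEAR-ALIAS FLOOR (`n ≥ 2`)**: `M_λ(s) ≤ y_λ^{(n)}(s) = Δ₀φ_λ^{(n)}(s)` on the punctured zone. [folklore] -/
theorem Mfloor_le_xIn_of_two_le (n : ℕ) [NeZero n] (hn : 2 ≤ n) (s : Fin d → ℝ)
    (hs : ∀ ν, |s ν| ≤ Real.pi) (ν₀ : Fin d) (hν₀ : s ν₀ ≠ 0) (lam : Fin d) :
    Mfloor s lam ≤ xIn n s lam := by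
  have hn1 : 1 ≤ n := by omega
  have hD0 : 0 ≤ Delta1r 0 s := (Delta1r_pos s hs ν₀ hν₀).le
  unfold xIn
  rw [phi162_eq n hn1 lam s hs, Finset.mul_sum]
  set T : (Fin d → Fin n) → ℝ := fun k =>
    Delta1r 0 s * (Ur n k s * uFactorr n (k lam : ℕ) (s lam) / DeltaXir n 0 (shiftr n k s)) with hT
  have hT0 : ∀ k, 0 ≤ T k := fun k => mul_nonneg hD0 (phiMu_term_nonneg n lam s k)
  -- restrict the alias sum to the image of `kSel`
  have h1 : ∑ k ∈ (Finset.univ : Finset (Finset (Fin d))).image (kSel n hn s), T k ≤ ∑ k, T k :=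
    Finset.sum_le_sum_of_subset_of_nonneg (Finset.subset_univ _) fun k _ _ => hT0 k
  have h2 : ∑ k ∈ (Finset.univ : Finset (Finset (Fin d))).image (kSel n hn s), T k
      = ∑ K : Finset (Fin d), T (kSel n hn s K) :=
    Finset.sum_image fun K _ K' _ h => kSel_injective h
  -- termwise domination
  have h3 : ∀ K : Finset (Fin d), qJ * ∏ ν, eSel s lam K ν ≤ T (kSel n hn s K) := by
    intro K
    rw [← term_eq_prod_eSel lam K]
    have e : T (kSel n hn s K) = Ur n (kSel n hn s K) s
        * uFactorr n ((kSel n hn s K lam : Fin n) : ℕ) (s lam)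
        * (Delta1r 0 s / DeltaXir n 0 (shiftr n (kSel n hn s K) s)) := by
      simp only [hT]; ring
    rw [e]
    exact term_ge hs ν₀ hν₀ lam K
  calc Mfloor s lam = ∑ K : Finset (Fin d), qJ * ∏ ν, eSel s lam K ν := (sum_prod_eSel lam).symm
    _ ≤ ∑ K : Finset (Fin d), T (kSel n hn s K) := Finset.sum_le_sum fun K _ => h3 K
    _ = ∑ k ∈ (Finset.univ : Finset (Finset (Fin d))).image (kSel n hn s), T k := h2.symm
    _ ≤ ∑ k, T k := h1

end Floor

/-! ## §4 All levels, the recovered `γ₀`, and the one-dimensional socket -/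

section Socket

/-- `M_λ(s) ≤ 1` (through level `n = 2` and `Δ₀φ ≤ 1`). [folklore] -/
theorem Mfloor_le_one (s : Fin d → ℝ) (hs : ∀ ν, |s ν| ≤ Real.pi) (ν₀ : Fin d) (hν₀ : s ν₀ ≠ 0)
    (lam : Fin d) : Mfloor s lam ≤ 1 :=
  le_trans (Mfloor_le_xIn_of_two_le 2 le_rfl s hs ν₀ hν₀ lam) (Delta0_phi162_le_one 2 (by norm_num) lam s hs)

/-- **THE NEAR-ALIAS FLOOR, ALL LEVELS `n ≥ 1`**: `M_λ(s) ≤ Δ₀φ_λ^{(n)}(s)` on the punctured Brillouin zone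
(`n = 1`: `Δ₀φ ≡ 1`). [folklore] -/
theorem Mfloor_le_xIn (n : ℕ) [NeZero n] (hn : 1 ≤ n) (s : Fin d → ℝ) (hs : ∀ ν, |s ν| ≤ Real.pi)
    (ν₀ : Fin d) (hν₀ : s ν₀ ≠ 0) (lam : Fin d) : Mfloor s lam ≤ xIn n s lam := by
  rcases Nat.lt_or_ge n 2 with h | h
  · have h1 : n = 1 := by omega
    subst h1
    have e : xIn 1 s lam = 1 := by
      unfold xIn; rw [phi162_one lam s hs, mul_inv_cancel₀ (Delta1r_pos s hs ν₀ hν₀).ne']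
    rw [e]; exact Mfloor_le_one s hs ν₀ hν₀ lam
  · exact Mfloor_le_xIn_of_two_le n h s hs ν₀ hν₀ lam

/-- lower bound of the minorant from one-dimensional bounds: `g₀ ≤ g`, `h₀ ≤ h` on `[−π,π]` give
`q·g₀^{d−1}·h₀ ≤ M_λ(s)`. [folklore] -/
theorem Mfloor_ge_of_oneDim {g₀ h₀ : ℝ} (hg₀ : 0 ≤ g₀) (hh₀ : 0 ≤ h₀)
    (hg : ∀ x : ℝ, |x| ≤ Real.pi → g₀ ≤ gFun x) (hh : ∀ x : ℝ, |x| ≤ Real.pi → h₀ ≤ hFun x)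
    (s : Fin d → ℝ) (hs : ∀ ν, |s ν| ≤ Real.pi) (lam : Fin d) :
    qJ * (g₀ ^ (d - 1) * h₀) ≤ Mfloor s lam := by
  unfold Mfloor
  have h1 : g₀ ^ (d - 1) ≤ ∏ ν ∈ Finset.univ.erase lam, gFun (s ν) := by
    have e : g₀ ^ (d - 1) = ∏ _ν ∈ Finset.univ.erase lam, g₀ := by
      rw [Finset.prod_const, Finset.card_erase_of_mem (Finset.mem_univ lam), Finset.card_univ,
        Fintype.card_fin]
    rw [e]
    exact Finset.prod_le_prod (fun ν _ => hg₀) fun ν _ => hg (s ν) (hs ν)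
  have h2 : h₀ ≤ hFun (s lam) := hh (s lam) (hs lam)
  have h3 : 0 ≤ ∏ ν ∈ Finset.univ.erase lam, gFun (s ν) :=
    Finset.prod_nonneg fun ν _ => (gFun_pos (s ν) (hs ν)).le
  exact mul_le_mul_of_nonneg_left (mul_le_mul h1 h2 hh₀ h3) qJ_pos.le

/-- **THE SOCKET**: two ONE-DIMENSIONAL inequalities `g₀ ≤ σ + τ²/q`, `h₀ ≤ σ² + τ³/q` on `[−π,π]` give the
`n`-UNIFORM floor `q·g₀^{d−1}·h₀ ≤ Δ₀φ_λ^{(n)}(s)` for all `n ≥ 1`, `s ≠ 0`, `λ` — lever (1) of the asym1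
constant ledger reduced to two 1-D certifications (`g₀, h₀` are BINDERS here; §5 discharges them with
`0.71, 0.3` in-kernel; the float optimum would be `0.7326, 0.3193`, i.e. `11.5·γ₀` at `d = 4`). [folklore] -/
theorem xIn_floor_of_oneDim {g₀ h₀ : ℝ} (hg₀ : 0 ≤ g₀) (hh₀ : 0 ≤ h₀)
    (hg : ∀ x : ℝ, |x| ≤ Real.pi → g₀ ≤ gFun x) (hh : ∀ x : ℝ, |x| ≤ Real.pi → h₀ ≤ hFun x)
    (n : ℕ) [NeZero n] (hn : 1 ≤ n) (s : Fin d → ℝ) (hs : ∀ ν, |s ν| ≤ Real.pi)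
    (ν₀ : Fin d) (hν₀ : s ν₀ ≠ 0) (lam : Fin d) : qJ * (g₀ ^ (d - 1) * h₀) ≤ xIn n s lam :=
  le_trans (Mfloor_ge_of_oneDim hg₀ hh₀ hg hh s hs lam) (Mfloor_le_xIn n hn s hs ν₀ hν₀ lam)

/-- … and along a tower `n = L^m` the same floor serves the monotone limit `y_∞ = ⨅_m y^{(L^m)}`
(`MonotoneScales.xIn_tendsto_iInf`). [folklore] -/
theorem iInf_xIn_floor_of_oneDim {g₀ h₀ : ℝ} (hg₀ : 0 ≤ g₀) (hh₀ : 0 ≤ h₀)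
    (hg : ∀ x : ℝ, |x| ≤ Real.pi → g₀ ≤ gFun x) (hh : ∀ x : ℝ, |x| ≤ Real.pi → h₀ ≤ hFun x)
    (L : ℕ) (hL : 1 ≤ L) (s : Fin d → ℝ) (hs : ∀ ν, |s ν| ≤ Real.pi) (ν₀ : Fin d) (hν₀ : s ν₀ ≠ 0)
    (lam : Fin d) :
    qJ * (g₀ ^ (d - 1) * h₀) ≤ ⨅ m : ℕ, @xIn d (L ^ m) s lam := by
  refine le_ciInf fun m => ?_
  haveI : NeZero (L ^ m) := ⟨pow_ne_zero m (Nat.one_le_iff_ne_zero.mp hL)⟩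
  exact xIn_floor_of_oneDim hg₀ hh₀ hg hh (L ^ m) (Nat.one_le_pow m L hL) s hs ν₀ hν₀ lam

/-- CONSISTENCY: with the trivial one-dimensional bounds `q ≤ g`, `q² ≤ h` the socket returns exactly the
tree's `γ₀ = q^{d+2}` (`gam0`; `B5Bounds167Lattice.Delta0_phi162_lower`) for `d ≥ 1`. [folklore] -/
theorem gam0_le_Mfloor (hd : 1 ≤ d) (s : Fin d → ℝ) (hs : ∀ ν, |s ν| ≤ Real.pi) (lam : Fin d) :
    gam0 d ≤ Mfloor s lam := by
  have h := Mfloor_ge_of_oneDim (d := d) qJ_pos.le (pow_nonneg qJ_pos.le 2) qJ_le_gFun qJ_sq_le_hFun s hs lam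
  have e : qJ * (qJ ^ (d - 1) * qJ ^ 2) = gam0 d := by
    unfold gam0 qJ
    obtain ⟨d', rfl⟩ : ∃ d', d = d' + 1 := ⟨d - 1, by omega⟩
    simp only [Nat.add_sub_cancel]
    ring
  rw [← e]; exact h

/-- the corner value: at `s = (π,…,π)` every `σ = τ = q`, so `M = 2^d·q^{d+2} = 2^d·γ₀` — the minorant is
the FULL near-alias sum there (the tree's `γ₀` is `2^{−d}` of it). [folklore] -/
theorem Mfloor_corner (hd : 1 ≤ d) (lam : Fin d) :
    Mfloor (fun _ : Fin d => Real.pi) lam = 2 ^ d * gam0 d := by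
  have hpi := Real.pi_pos
  have hq : qJ ≠ 0 := qJ_pos.ne'
  have hS : S1r Real.pi = 4 := by unfold S1r; rw [Real.cos_pi]; ring
  have hσ : sig0 Real.pi = qJ := by
    unfold sig0 qJ; rw [if_neg hpi.ne', hS]
  have hτ : tauF Real.pi = qJ := by
    unfold tauF qJ; rw [abs_of_pos hpi, hS]; ring
  have hg : gFun Real.pi = 2 * qJ := by
    unfold gFun; rw [hσ, hτ]; field_simp; ring
  have hh : hFun Real.pi = 2 * qJ ^ 2 := by
    unfold hFun; rw [hσ, hτ]; field_simp; ring
  unfold Mfloor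
  simp only [hg, hh]
  rw [Finset.prod_const, Finset.card_erase_of_mem (Finset.mem_univ lam), Finset.card_univ, Fintype.card_fin]
  unfold gam0
  rw [show (4 / Real.pi ^ 2 : ℝ) = qJ from rfl]
  obtain ⟨d', rfl⟩ : ∃ d', d = d' + 1 := ⟨d - 1, by omega⟩
  simp only [Nat.add_sub_cancel]
  ring

end Socket


/-! ## §5 Unconditional one-dimensional bounds: `g ≥ 0.71`, `h ≥ 0.3` on `[−π,π]`, hence the `n`-uniform floor
`y ≥ q·0.71^{d−1}·0.3` (`≥ 0.0435 ≥ 9.8·γ₀` at `d = 4`; the tree's floor is `γ₀`) -/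

section OneDimBounds

/-- `σ` is even. [folklore] -/
theorem sig0_abs (x : ℝ) : sig0 |x| = sig0 x := by
  unfold sig0 S1r
  simp only [abs_eq_zero, Real.cos_abs, sq_abs]

/-- `τ` is even. [folklore] -/
theorem tauF_abs (x : ℝ) : tauF |x| = tauF x := by
  unfold tauF S1r; rw [abs_abs, Real.cos_abs]

/-- `g` is even. [folklore] -/
theorem gFun_abs (x : ℝ) : gFun |x| = gFun x := by unfold gFun; rw [sig0_abs, tauF_abs]

/-- `h` is even. [folklore] -/
theorem hFun_abs (x : ℝ) : hFun |x| = hFun x := by unfold hFun; rw [sig0_abs, tauF_abs]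

/-- `sin(y/2) ≥ 1 − (π − y)²/8` (`cos u ≥ 1 − u²/2` at `u = (π − y)/2`): a POLYNOMIAL minorant, sharp near `y = π`
where the minima of `g, h` sit — no radicals needed downstream. [folklore] -/
theorem one_sub_le_sin_half (y : ℝ) : 1 - (Real.pi - y) ^ 2 / 8 ≤ Real.sin (y / 2) := by
  have h := Real.one_sub_sq_div_two_le_cos (x := (Real.pi - y) / 2)
  have e : Real.cos ((Real.pi - y) / 2) = Real.sin (y / 2) := by
    rw [show (Real.pi - y) / 2 = Real.pi / 2 - y / 2 by ring, Real.cos_pi_div_two_sub]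
  have e2 : ((Real.pi - y) / 2) ^ 2 / 2 = (Real.pi - y) ^ 2 / 8 := by ring
  rw [e2, e] at h
  exact h

/-- `S₁(y) ≥ 4(1 − (π−y)²/8)²` whenever the bracket is `≥ 0`. [folklore] -/
theorem S1r_ge_poly (y : ℝ) (hc : 0 ≤ 1 - (Real.pi - y) ^ 2 / 8) :
    4 * (1 - (Real.pi - y) ^ 2 / 8) ^ 2 ≤ S1r y := by
  rw [S1r_eq]
  have h := one_sub_le_sin_half y
  have h2 := pow_le_pow_left₀ hc h 2
  linarith

/-- `σ ≤ 1` (`S₁(x) ≤ x²`). [folklore] -/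
theorem sig0_le_one (x : ℝ) : sig0 x ≤ 1 := by
  unfold sig0; split_ifs with h0
  · exact le_rfl
  · rw [div_le_one (by positivity)]
    have := Sxir_le 1 x
    simpa [Sxir, S1r] using this

/-- `σ` is ANTITONE on `[0,π]` (chord of the concave `sin` on `[0,π]` through the origin). [folklore] -/
theorem sig0_anti {x x₁ : ℝ} (h0 : 0 ≤ x) (h : x ≤ x₁) (h1 : x₁ ≤ Real.pi) (hx1 : 0 < x₁) :
    sig0 x₁ ≤ sig0 x := by
  rcases eq_or_lt_of_le h0 with heq | hpos
  · rw [← heq]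
    have e : sig0 0 = 1 := by simp [sig0]
    rw [e]; exact sig0_le_one x₁
  · have hconc := strictConcaveOn_sin_Icc.concaveOn
    have hmem0 : (0 : ℝ) ∈ Set.Icc 0 Real.pi := ⟨le_rfl, Real.pi_pos.le⟩
    have hmem1 : x₁ / 2 ∈ Set.Icc 0 Real.pi := ⟨by linarith, by linarith⟩
    set t := x / x₁ with ht
    have ht0 : 0 ≤ t := div_nonneg h0 hx1.le
    have ht1 : t ≤ 1 := (div_le_one hx1).mpr h
    have key := hconc.2 hmem0 hmem1 (by linarith : 0 ≤ 1 - t) ht0 (by ring : 1 - t + t = 1)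
    simp only [smul_eq_mul, Real.sin_zero, mul_zero, zero_add] at key
    have e : t * (x₁ / 2) = x / 2 := by rw [ht]; field_simp
    rw [e] at key
    have hs1 : 0 ≤ Real.sin (x₁ / 2) := Real.sin_nonneg_of_nonneg_of_le_pi (by linarith) (by linarith)
    have hk0 : 0 ≤ t * Real.sin (x₁ / 2) := mul_nonneg ht0 hs1
    have hsq := pow_le_pow_left₀ hk0 key 2
    have e2 : (t * Real.sin (x₁ / 2)) ^ 2 * x₁ ^ 2 = Real.sin (x₁ / 2) ^ 2 * x ^ 2 := by
      rw [ht]; field_simp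
    unfold sig0
    rw [if_neg hpos.ne', if_neg hx1.ne', S1r_eq, S1r_eq, div_le_div_iff₀ (by positivity) (by positivity)]
    nlinarith [mul_le_mul_of_nonneg_right hsq (sq_nonneg x₁), e2]

/-- `τ` is MONOTONE on `[0,π]` (`cos` antitone on `[0,π]`, `(2π − x)²` antitone). [folklore] -/
theorem tauF_mono {x₀ x : ℝ} (h0 : 0 ≤ x₀) (h : x₀ ≤ x) (hπ : x ≤ Real.pi) : tauF x₀ ≤ tauF x := by
  unfold tauF
  have hpi := Real.pi_pos
  rw [abs_of_nonneg h0, abs_of_nonneg (le_trans h0 h)]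
  have h1 : S1r x₀ ≤ S1r x := by
    unfold S1r
    have := Real.cos_le_cos_of_nonneg_of_le_pi h0 hπ h
    linarith
  have h2 : (2 * Real.pi - x) ^ 2 ≤ (2 * Real.pi - x₀) ^ 2 := by nlinarith
  have h3 : 0 < (2 * Real.pi - x) ^ 2 := by
    have : 0 < 2 * Real.pi - x := by linarith
    positivity
  calc S1r x₀ / (2 * Real.pi - x₀) ^ 2 ≤ S1r x / (2 * Real.pi - x₀) ^ 2 :=
        div_le_div_of_nonneg_right h1 (sq_nonneg _)
    _ ≤ S1r x / (2 * Real.pi - x) ^ 2 := div_le_div_of_nonneg_left (S1r_nonneg x) h3 h2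

/-- on a piece `[a,b] ⊆ [0,π]`: `g ≥ σ(b) + τ(a)²/q`, `h ≥ σ(b)² + τ(a)³/q`. [folklore] -/
theorem piece_bounds {a b x : ℝ} (ha : 0 ≤ a) (hax : a ≤ x) (hxb : x ≤ b) (hb : b ≤ Real.pi)
    (hb0 : 0 < b) : sig0 b + tauF a ^ 2 / qJ ≤ gFun x ∧ sig0 b ^ 2 + tauF a ^ 3 / qJ ≤ hFun x := by
  have hx0 : 0 ≤ x := le_trans ha hax
  have h1 : sig0 b ≤ sig0 x := sig0_anti hx0 hxb hb hb0
  have h2 : tauF a ≤ tauF x := tauF_mono ha hax (le_trans hxb hb)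
  have ht0 : 0 ≤ tauF a := tauF_nonneg a
  have hs0 : 0 ≤ sig0 b := sig0_nonneg b
  have hq := qJ_pos
  unfold gFun hFun
  constructor
  · have : tauF a ^ 2 / qJ ≤ tauF x ^ 2 / qJ :=
      div_le_div_of_nonneg_right (pow_le_pow_left₀ ht0 h2 2) hq.le
    linarith
  · have e1 : sig0 b ^ 2 ≤ sig0 x ^ 2 := pow_le_pow_left₀ hs0 h1 2
    have : tauF a ^ 3 / qJ ≤ tauF x ^ 3 / qJ :=
      div_le_div_of_nonneg_right (pow_le_pow_left₀ ht0 h2 3) hq.le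
    linarith

/-- rational envelopes: `π ≤ 3.1416 =: π⁺`, `π ≥ 3.141592 =: π⁻`. [folklore] -/
def piHi : ℝ := 3.1416

/-- see `piHi`. [folklore] -/
def piLo : ℝ := 3.141592

/-- `π ≤ π⁺` (`Real.pi_lt_d4`). [folklore] -/
theorem pi_le_piHi : Real.pi ≤ piHi := Real.pi_lt_d4.le

/-- `π⁻ ≤ π` (`Real.pi_gt_d6`). [folklore] -/
theorem piLo_le_pi : piLo ≤ Real.pi := Real.pi_gt_d6.le

/-- `c⁺(r) = 1 − (π⁺(1−r))²/8 ≤ 1 − (π − rπ)²/8 ≤ sin(rπ/2)`. [folklore] -/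
def cE (r : ℝ) : ℝ := 1 - (piHi * (1 - r)) ^ 2 / 8

/-- rational minorant of `σ(rπ)`. [folklore] -/
def sigE (r : ℝ) : ℝ := 4 * cE r ^ 2 / (r * piHi) ^ 2

/-- rational minorant of `τ(rπ)`. [folklore] -/
def tauE (r : ℝ) : ℝ := 4 * cE r ^ 2 / ((2 - r) * piHi) ^ 2

/-- rational minorant of `g` on the piece `[rπ, r'π]`. [folklore] -/
def PhiG (r r' : ℝ) : ℝ := sigE r' + tauE r ^ 2 * (piLo ^ 2 / 4)

/-- rational minorant of `h` on the piece `[rπ, r'π]`. [folklore] -/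
def PhiH (r r' : ℝ) : ℝ := sigE r' ^ 2 + tauE r ^ 3 * (piLo ^ 2 / 4)

/-- `c⁺(r) ≥ 0` for `1/2 ≤ r ≤ 1`. [folklore] -/
theorem cE_nonneg (r : ℝ) (hr : 1 / 2 ≤ r) (hr1 : r ≤ 1) : 0 ≤ cE r := by
  unfold cE piHi; nlinarith

/-- `c⁺(r) ≤ 1 − (π − rπ)²/8` (`π ≤ π⁺`). [folklore] -/
theorem cE_le (r : ℝ) (hr1 : r ≤ 1) : cE r ≤ 1 - (Real.pi - r * Real.pi) ^ 2 / 8 := by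
  unfold cE
  have h1 : Real.pi - r * Real.pi = Real.pi * (1 - r) := by ring
  rw [h1]
  have h2 : (Real.pi * (1 - r)) ^ 2 ≤ (piHi * (1 - r)) ^ 2 :=
    pow_le_pow_left₀ (mul_nonneg Real.pi_pos.le (by linarith))
      (mul_le_mul_of_nonneg_right pi_le_piHi (by linarith)) 2
  linarith

/-- `S₁(rπ) ≥ 4c⁺(r)²`. [folklore] -/
theorem S1r_ge_cE (r : ℝ) (hr : 1 / 2 ≤ r) (hr1 : r ≤ 1) : 4 * cE r ^ 2 ≤ S1r (r * Real.pi) := by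
  have h0 := cE_nonneg r hr hr1
  have h1 := cE_le r hr1
  have h2 := S1r_ge_poly (r * Real.pi) (le_trans h0 h1)
  have h3 : cE r ^ 2 ≤ (1 - (Real.pi - r * Real.pi) ^ 2 / 8) ^ 2 := pow_le_pow_left₀ h0 h1 2
  linarith

/-- `σ⁻(r) ≤ σ(rπ)`. [folklore] -/
theorem sigE_le_sig0 (r : ℝ) (hr : 1 / 2 ≤ r) (hr1 : r ≤ 1) : sigE r ≤ sig0 (r * Real.pi) := by
  have hpi := Real.pi_pos
  have hr0 : 0 < r := by linarith
  have hH : 0 < piHi := by unfold piHi; norm_num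
  unfold sigE sig0
  rw [if_neg (by positivity)]
  calc 4 * cE r ^ 2 / (r * piHi) ^ 2 ≤ 4 * cE r ^ 2 / (r * Real.pi) ^ 2 :=
        div_le_div_of_nonneg_left (by positivity) (by positivity)
          (pow_le_pow_left₀ (by positivity) (mul_le_mul_of_nonneg_left pi_le_piHi hr0.le) 2)
    _ ≤ S1r (r * Real.pi) / (r * Real.pi) ^ 2 :=
        div_le_div_of_nonneg_right (S1r_ge_cE r hr hr1) (sq_nonneg _)

/-- `τ⁻(r) ≤ τ(rπ)`. [folklore] -/
theorem tauE_le_tauF (r : ℝ) (hr : 1 / 2 ≤ r) (hr1 : r ≤ 1) : tauE r ≤ tauF (r * Real.pi) := by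
  have hpi := Real.pi_pos
  have hH : 0 < piHi := by unfold piHi; norm_num
  unfold tauE tauF
  rw [abs_of_nonneg (by positivity)]
  have h1 : 0 < (2 - r) * Real.pi := by nlinarith
  have e : 2 * Real.pi - r * Real.pi = (2 - r) * Real.pi := by ring
  rw [e]
  calc 4 * cE r ^ 2 / ((2 - r) * piHi) ^ 2 ≤ 4 * cE r ^ 2 / ((2 - r) * Real.pi) ^ 2 :=
        div_le_div_of_nonneg_left (by positivity) (by positivity)
          (pow_le_pow_left₀ h1.le (mul_le_mul_of_nonneg_left pi_le_piHi (by linarith)) 2)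
    _ ≤ S1r (r * Real.pi) / ((2 - r) * Real.pi) ^ 2 :=
        div_le_div_of_nonneg_right (S1r_ge_cE r hr hr1) (sq_nonneg _)

/-- `τ⁻ ≥ 0`. [folklore] -/
theorem tauE_nonneg (r : ℝ) : 0 ≤ tauE r := by unfold tauE; positivity

/-- `σ⁻ ≥ 0`. [folklore] -/
theorem sigE_nonneg (r : ℝ) : 0 ≤ sigE r := by unfold sigE; positivity

/-- `t/q = t·π²/4 ≥ t·(π⁻)²/4`. [folklore] -/
theorem mul_piLo_le_div_qJ (t : ℝ) (ht : 0 ≤ t) : t * (piLo ^ 2 / 4) ≤ t / qJ := by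
  unfold qJ
  have hL : 0 ≤ piLo := by unfold piLo; norm_num
  have h1 : piLo ^ 2 ≤ Real.pi ^ 2 := pow_le_pow_left₀ hL piLo_le_pi 2
  have hpi := Real.pi_pos
  have e : t / (4 / Real.pi ^ 2) = t * (Real.pi ^ 2 / 4) := by field_simp
  rw [e]
  exact mul_le_mul_of_nonneg_left (by linarith) ht

/-- the envelope on a generic piece `[rπ, r'π]`, `1/2 ≤ r ≤ r' ≤ 1`. [folklore] -/
theorem piece_envelope (r r' : ℝ) (hr : 1 / 2 ≤ r) (hrr : r ≤ r') (hr' : r' ≤ 1) {x : ℝ}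
    (h1 : r * Real.pi ≤ x) (h2 : x ≤ r' * Real.pi) : PhiG r r' ≤ gFun x ∧ PhiH r r' ≤ hFun x := by
  have hpi := Real.pi_pos
  have hb0 : 0 < r' * Real.pi := by nlinarith
  have hb : r' * Real.pi ≤ Real.pi := by nlinarith
  have ha : 0 ≤ r * Real.pi := by nlinarith
  obtain ⟨hg, hh⟩ := piece_bounds ha h1 h2 hb hb0
  have e1 := sigE_le_sig0 r' (le_trans hr hrr) hr'
  have e2 := tauE_le_tauF r hr (le_trans hrr hr')
  have t0 := tauE_nonneg r
  have s0 := sigE_nonneg r'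
  have e3 : tauE r ^ 2 ≤ tauF (r * Real.pi) ^ 2 := pow_le_pow_left₀ t0 e2 2
  have e4 : tauE r ^ 3 ≤ tauF (r * Real.pi) ^ 3 := pow_le_pow_left₀ t0 e2 3
  have e5 : sigE r' ^ 2 ≤ sig0 (r' * Real.pi) ^ 2 := pow_le_pow_left₀ s0 e1 2
  have q2 := mul_piLo_le_div_qJ (tauF (r * Real.pi) ^ 2) (pow_nonneg (tauF_nonneg _) 2)
  have q3 := mul_piLo_le_div_qJ (tauF (r * Real.pi) ^ 3) (pow_nonneg (tauF_nonneg _) 3)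
  have pl : 0 ≤ piLo ^ 2 / 4 := by unfold piLo; norm_num
  unfold PhiG PhiH
  constructor
  · linarith [mul_le_mul_of_nonneg_right e3 pl]
  · linarith [mul_le_mul_of_nonneg_right e4 pl]

/-- the first piece `[0, π/2]`: `g ≥ σ(π/2)`, `h ≥ σ(π/2)²`. [folklore] -/
theorem first_piece {x : ℝ} (h0 : 0 ≤ x) (h2 : x ≤ 1 / 2 * Real.pi) :
    sigE (1 / 2) ≤ gFun x ∧ sigE (1 / 2) ^ 2 ≤ hFun x := by
  have hpi := Real.pi_pos
  have hb0 : 0 < 1 / 2 * Real.pi := by positivity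
  have hb : 1 / 2 * Real.pi ≤ Real.pi := by linarith
  have h1 : sig0 (1 / 2 * Real.pi) ≤ sig0 x := sig0_anti h0 h2 hb hb0
  have e1 := sigE_le_sig0 (1 / 2) le_rfl (by norm_num)
  have s0 := sigE_nonneg (1 / 2 : ℝ)
  have t1 : 0 ≤ tauF x ^ 2 / qJ := div_nonneg (pow_nonneg (tauF_nonneg x) 2) qJ_pos.le
  have t2 : 0 ≤ tauF x ^ 3 / qJ := div_nonneg (pow_nonneg (tauF_nonneg x) 3) qJ_pos.le
  unfold gFun hFun
  constructor
  · linarith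
  · have := pow_le_pow_left₀ s0 (le_trans e1 h1) 2
    linarith

/-- the certified one-dimensional constants (21 pieces of `[π/2, π]` of width `π/40`, polynomial `sin`
minorant; float minima `0.732668…`, `0.319386…` — certifiable targets are truncations `≤ 0.7326`, `≤ 0.3193`). [folklore] -/
def g0c : ℝ := 0.71

/-- see `g0c`. [folklore] -/
def h0c : ℝ := 0.3

/-- `0.71 > 0`. [folklore] -/
theorem g0c_pos : 0 < g0c := by unfold g0c; norm_num

/-- `0.3 > 0`. [folklore] -/
theorem h0c_pos : 0 < h0c := by unfold h0c; norm_num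

/-- **`g ≥ 0.71` and `h ≥ 0.3` on `[−π,π]`** (unconditional; 1 + 20 pieces, each a rational evaluation). [folklore] -/
theorem gh_lower (x : ℝ) (hx : |x| ≤ Real.pi) : g0c ≤ gFun x ∧ h0c ≤ hFun x := by
  rw [← gFun_abs x, ← hFun_abs x]
  have h0 : 0 ≤ |x| := abs_nonneg x
  have hpi := Real.pi_pos
  unfold g0c h0c
  rcases le_or_gt |x| (1 / 2 * Real.pi) with hA | hA
  · obtain ⟨hg, hh⟩ := first_piece h0 hA
    exact ⟨le_trans (by norm_num [sigE, cE, piHi]) hg, le_trans (by norm_num [sigE, cE, piHi]) hh⟩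
  rcases le_or_gt |x| (21 / 40 * Real.pi) with h1 | h1
  · obtain ⟨hg, hh⟩ := piece_envelope (1 / 2) (21 / 40) (by norm_num) (by norm_num) (by norm_num) hA.le h1
    exact ⟨le_trans (by norm_num [PhiG, sigE, tauE, cE, piHi, piLo]) hg,
      le_trans (by norm_num [PhiH, sigE, tauE, cE, piHi, piLo]) hh⟩
  rcases le_or_gt |x| (11 / 20 * Real.pi) with h2 | h2
  · obtain ⟨hg, hh⟩ := piece_envelope (21 / 40) (11 / 20) (by norm_num) (by norm_num) (by norm_num) h1.le h2
    exact ⟨le_trans (by norm_num [PhiG, sigE, tauE, cE, piHi, piLo]) hg,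
      le_trans (by norm_num [PhiH, sigE, tauE, cE, piHi, piLo]) hh⟩
  rcases le_or_gt |x| (23 / 40 * Real.pi) with h3 | h3
  · obtain ⟨hg, hh⟩ := piece_envelope (11 / 20) (23 / 40) (by norm_num) (by norm_num) (by norm_num) h2.le h3
    exact ⟨le_trans (by norm_num [PhiG, sigE, tauE, cE, piHi, piLo]) hg,
      le_trans (by norm_num [PhiH, sigE, tauE, cE, piHi, piLo]) hh⟩
  rcases le_or_gt |x| (3 / 5 * Real.pi) with h4 | h4
  · obtain ⟨hg, hh⟩ := piece_envelope (23 / 40) (3 / 5) (by norm_num) (by norm_num) (by norm_num) h3.le h4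
    exact ⟨le_trans (by norm_num [PhiG, sigE, tauE, cE, piHi, piLo]) hg,
      le_trans (by norm_num [PhiH, sigE, tauE, cE, piHi, piLo]) hh⟩
  rcases le_or_gt |x| (5 / 8 * Real.pi) with h5 | h5
  · obtain ⟨hg, hh⟩ := piece_envelope (3 / 5) (5 / 8) (by norm_num) (by norm_num) (by norm_num) h4.le h5
    exact ⟨le_trans (by norm_num [PhiG, sigE, tauE, cE, piHi, piLo]) hg,
      le_trans (by norm_num [PhiH, sigE, tauE, cE, piHi, piLo]) hh⟩
  rcases le_or_gt |x| (13 / 20 * Real.pi) with h6 | h6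
  · obtain ⟨hg, hh⟩ := piece_envelope (5 / 8) (13 / 20) (by norm_num) (by norm_num) (by norm_num) h5.le h6
    exact ⟨le_trans (by norm_num [PhiG, sigE, tauE, cE, piHi, piLo]) hg,
      le_trans (by norm_num [PhiH, sigE, tauE, cE, piHi, piLo]) hh⟩
  rcases le_or_gt |x| (27 / 40 * Real.pi) with h7 | h7
  · obtain ⟨hg, hh⟩ := piece_envelope (13 / 20) (27 / 40) (by norm_num) (by norm_num) (by norm_num) h6.le h7
    exact ⟨le_trans (by norm_num [PhiG, sigE, tauE, cE, piHi, piLo]) hg,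
      le_trans (by norm_num [PhiH, sigE, tauE, cE, piHi, piLo]) hh⟩
  rcases le_or_gt |x| (7 / 10 * Real.pi) with h8 | h8
  · obtain ⟨hg, hh⟩ := piece_envelope (27 / 40) (7 / 10) (by norm_num) (by norm_num) (by norm_num) h7.le h8
    exact ⟨le_trans (by norm_num [PhiG, sigE, tauE, cE, piHi, piLo]) hg,
      le_trans (by norm_num [PhiH, sigE, tauE, cE, piHi, piLo]) hh⟩
  rcases le_or_gt |x| (29 / 40 * Real.pi) with h9 | h9
  · obtain ⟨hg, hh⟩ := piece_envelope (7 / 10) (29 / 40) (by norm_num) (by norm_num) (by norm_num) h8.le h9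
    exact ⟨le_trans (by norm_num [PhiG, sigE, tauE, cE, piHi, piLo]) hg,
      le_trans (by norm_num [PhiH, sigE, tauE, cE, piHi, piLo]) hh⟩
  rcases le_or_gt |x| (3 / 4 * Real.pi) with h10 | h10
  · obtain ⟨hg, hh⟩ := piece_envelope (29 / 40) (3 / 4) (by norm_num) (by norm_num) (by norm_num) h9.le h10
    exact ⟨le_trans (by norm_num [PhiG, sigE, tauE, cE, piHi, piLo]) hg,
      le_trans (by norm_num [PhiH, sigE, tauE, cE, piHi, piLo]) hh⟩
  rcases le_or_gt |x| (31 / 40 * Real.pi) with h11 | h11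
  · obtain ⟨hg, hh⟩ := piece_envelope (3 / 4) (31 / 40) (by norm_num) (by norm_num) (by norm_num) h10.le h11
    exact ⟨le_trans (by norm_num [PhiG, sigE, tauE, cE, piHi, piLo]) hg,
      le_trans (by norm_num [PhiH, sigE, tauE, cE, piHi, piLo]) hh⟩
  rcases le_or_gt |x| (4 / 5 * Real.pi) with h12 | h12
  · obtain ⟨hg, hh⟩ := piece_envelope (31 / 40) (4 / 5) (by norm_num) (by norm_num) (by norm_num) h11.le h12
    exact ⟨le_trans (by norm_num [PhiG, sigE, tauE, cE, piHi, piLo]) hg,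
      le_trans (by norm_num [PhiH, sigE, tauE, cE, piHi, piLo]) hh⟩
  rcases le_or_gt |x| (33 / 40 * Real.pi) with h13 | h13
  · obtain ⟨hg, hh⟩ := piece_envelope (4 / 5) (33 / 40) (by norm_num) (by norm_num) (by norm_num) h12.le h13
    exact ⟨le_trans (by norm_num [PhiG, sigE, tauE, cE, piHi, piLo]) hg,
      le_trans (by norm_num [PhiH, sigE, tauE, cE, piHi, piLo]) hh⟩
  rcases le_or_gt |x| (17 / 20 * Real.pi) with h14 | h14
  · obtain ⟨hg, hh⟩ := piece_envelope (33 / 40) (17 / 20) (by norm_num) (by norm_num) (by norm_num) h13.le h14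
    exact ⟨le_trans (by norm_num [PhiG, sigE, tauE, cE, piHi, piLo]) hg,
      le_trans (by norm_num [PhiH, sigE, tauE, cE, piHi, piLo]) hh⟩
  rcases le_or_gt |x| (7 / 8 * Real.pi) with h15 | h15
  · obtain ⟨hg, hh⟩ := piece_envelope (17 / 20) (7 / 8) (by norm_num) (by norm_num) (by norm_num) h14.le h15
    exact ⟨le_trans (by norm_num [PhiG, sigE, tauE, cE, piHi, piLo]) hg,
      le_trans (by norm_num [PhiH, sigE, tauE, cE, piHi, piLo]) hh⟩
  rcases le_or_gt |x| (9 / 10 * Real.pi) with h16 | h16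
  · obtain ⟨hg, hh⟩ := piece_envelope (7 / 8) (9 / 10) (by norm_num) (by norm_num) (by norm_num) h15.le h16
    exact ⟨le_trans (by norm_num [PhiG, sigE, tauE, cE, piHi, piLo]) hg,
      le_trans (by norm_num [PhiH, sigE, tauE, cE, piHi, piLo]) hh⟩
  rcases le_or_gt |x| (37 / 40 * Real.pi) with h17 | h17
  · obtain ⟨hg, hh⟩ := piece_envelope (9 / 10) (37 / 40) (by norm_num) (by norm_num) (by norm_num) h16.le h17
    exact ⟨le_trans (by norm_num [PhiG, sigE, tauE, cE, piHi, piLo]) hg,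
      le_trans (by norm_num [PhiH, sigE, tauE, cE, piHi, piLo]) hh⟩
  rcases le_or_gt |x| (19 / 20 * Real.pi) with h18 | h18
  · obtain ⟨hg, hh⟩ := piece_envelope (37 / 40) (19 / 20) (by norm_num) (by norm_num) (by norm_num) h17.le h18
    exact ⟨le_trans (by norm_num [PhiG, sigE, tauE, cE, piHi, piLo]) hg,
      le_trans (by norm_num [PhiH, sigE, tauE, cE, piHi, piLo]) hh⟩
  rcases le_or_gt |x| (39 / 40 * Real.pi) with h19 | h19
  · obtain ⟨hg, hh⟩ := piece_envelope (19 / 20) (39 / 40) (by norm_num) (by norm_num) (by norm_num) h18.le h19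
    exact ⟨le_trans (by norm_num [PhiG, sigE, tauE, cE, piHi, piLo]) hg,
      le_trans (by norm_num [PhiH, sigE, tauE, cE, piHi, piLo]) hh⟩
  · have hlast : |x| ≤ 1 * Real.pi := by rw [one_mul]; exact hx
    obtain ⟨hg, hh⟩ := piece_envelope (39 / 40) 1 (by norm_num) (by norm_num) (by norm_num) h19.le hlast
    exact ⟨le_trans (by norm_num [PhiG, sigE, tauE, cE, piHi, piLo]) hg,
      le_trans (by norm_num [PhiH, sigE, tauE, cE, piHi, piLo]) hh⟩
end OneDimBounds

/-! ## §6 The unconditional `n`-uniform floor -/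

section Unconditional

/-- **the certified floor constant `C_floor(d) = q·0.71^{d−1}·0.3`**. [folklore] -/
def Cfloor (d : ℕ) : ℝ := qJ * (g0c ^ (d - 1) * h0c)

/-- `C_floor > 0`. [folklore] -/
theorem Cfloor_pos (d : ℕ) : 0 < Cfloor d := by
  unfold Cfloor; exact mul_pos qJ_pos (mul_pos (pow_pos g0c_pos _) h0c_pos)

/-- **THE UNCONDITIONAL `n`-UNIFORM FLOOR: `C_floor(d) ≤ Δ₀φ_λ^{(n)}(s)` for all `n ≥ 1`, `s ≠ 0` in the zone,
all `λ`** (tree: `γ₀ = q^{d+2}`; here `q·0.71^{d−1}·0.3`, i.e. `×9.8` at `d = 4`). [folklore] -/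
theorem Cfloor_le_xIn (n : ℕ) [NeZero n] (hn : 1 ≤ n) (s : Fin d → ℝ) (hs : ∀ ν, |s ν| ≤ Real.pi)
    (ν₀ : Fin d) (hν₀ : s ν₀ ≠ 0) (lam : Fin d) : Cfloor d ≤ xIn n s lam :=
  xIn_floor_of_oneDim g0c_pos.le h0c_pos.le (fun x hx => (gh_lower x hx).1)
    (fun x hx => (gh_lower x hx).2) n hn s hs ν₀ hν₀ lam

/-- … and for the monotone limit along any tower `n = L^m`. [folklore] -/
theorem Cfloor_le_iInf_xIn (L : ℕ) (hL : 1 ≤ L) (s : Fin d → ℝ) (hs : ∀ ν, |s ν| ≤ Real.pi)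
    (ν₀ : Fin d) (hν₀ : s ν₀ ≠ 0) (lam : Fin d) : Cfloor d ≤ ⨅ m : ℕ, @xIn d (L ^ m) s lam :=
  iInf_xIn_floor_of_oneDim g0c_pos.le h0c_pos.le (fun x hx => (gh_lower x hx).1)
    (fun x hx => (gh_lower x hx).2) L hL s hs ν₀ hν₀ lam

/-- the two-sided box with the new floor: `C_floor(d) ≤ y ≤ 1`. [folklore] -/
theorem xIn_mem_box' (n : ℕ) [NeZero n] (hn : 1 ≤ n) (s : Fin d → ℝ) (hs : ∀ ν, |s ν| ≤ Real.pi)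
    (ν₀ : Fin d) (hν₀ : s ν₀ ≠ 0) (lam : Fin d) : Cfloor d ≤ xIn n s lam ∧ xIn n s lam ≤ 1 :=
  ⟨Cfloor_le_xIn n hn s hs ν₀ hν₀ lam, (xIn_mem_box n hn s hs ν₀ hν₀ lam).2⟩

/-- `d = 4`: `C_floor(4) ≥ 0.0435` (`q ≥ 4/3.1416²`). [folklore] -/
theorem Cfloor_four_ge : (0.0435 : ℝ) ≤ Cfloor 4 := by
  unfold Cfloor g0c h0c qJ
  have hpi := Real.pi_pos
  have h1 : Real.pi ^ 2 ≤ piHi ^ 2 := pow_le_pow_left₀ hpi.le pi_le_piHi 2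
  have h2 : 4 / piHi ^ 2 ≤ 4 / Real.pi ^ 2 := div_le_div_of_nonneg_left (by norm_num) (by positivity) h1
  have h3 : (0.0435 : ℝ) ≤ 4 / piHi ^ 2 * ((0.71 : ℝ) ^ (4 - 1) * 0.3) := by unfold piHi; norm_num
  calc (0.0435 : ℝ) ≤ 4 / piHi ^ 2 * ((0.71 : ℝ) ^ (4 - 1) * 0.3) := h3
    _ ≤ 4 / Real.pi ^ 2 * ((0.71 : ℝ) ^ (4 - 1) * 0.3) :=
        mul_le_mul_of_nonneg_right h2 (by norm_num)

/-- `d = 4`: the new floor is at least `9.8·γ₀` (`γ₀ = q⁶ ≤ 0.00444`). [folklore] -/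
theorem gam0_four_le : (9.8 : ℝ) * gam0 4 ≤ Cfloor 4 := by
  have hq1 : qJ ≤ 4 / piLo ^ 2 := by
    unfold qJ
    have hL : 0 < piLo := by unfold piLo; norm_num
    exact div_le_div_of_nonneg_left (by norm_num) (by positivity) (pow_le_pow_left₀ hL.le piLo_le_pi 2)
  have hq0 := qJ_pos
  have e : gam0 4 = qJ * qJ ^ 5 := by unfold gam0 qJ; ring
  have h5 : qJ ^ 5 ≤ (4 / piLo ^ 2) ^ 5 := pow_le_pow_left₀ hq0.le hq1 5
  have h6 : (9.8 : ℝ) * (4 / piLo ^ 2) ^ 5 ≤ g0c ^ (4 - 1) * h0c := by unfold piLo g0c h0c; norm_num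
  rw [e]
  unfold Cfloor
  calc 9.8 * (qJ * qJ ^ 5) = qJ * (9.8 * qJ ^ 5) := by ring
    _ ≤ qJ * (9.8 * (4 / piLo ^ 2) ^ 5) := by
        apply mul_le_mul_of_nonneg_left _ hq0.le
        exact mul_le_mul_of_nonneg_left h5 (by norm_num)
    _ ≤ qJ * (g0c ^ (4 - 1) * h0c) := mul_le_mul_of_nonneg_left h6 hq0.le

end Unconditional

/-! ## §7 The chain above the certified floor — every floor binder of the lane discharged (v1.1)

Pure plumbing, appended v1.1 (statements of §1–§6 byte-unchanged).  With `Cfloor_le_xIn` the two-level floor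
hypotheses `y ≤ Δ₀φ^{(N)}`, `y ≤ Δ₀φ^{(RN)}` of `Beta.LogCloseRate` (§4–§7 there) and the finer-level /
all-levels floor hypotheses of `Beta.MonotoneScales` hold with `y := C_floor(d)` for ALL `N, R ≥ 1` and all
`p′ ≠ 0`, so every `_gam0` / tree-floor statement of those files gets a `_Cfloor` twin with `γ₀ ↦ C_floor(d)`:
relative tolerance `t_N = 4d·C_φ·C_floor(d)⁻¹·N⁻²` (`d = 4`: `4d·C_φ/γ₀ = 4173 ↦ ≤ 426`, `relConst_four_le`),
entry constant of `D_k` `16d²·(2/C_floor²)·C_φ` (`3.0·10⁷ ↦ ≤ 3.13·10⁵`, `entryConst_four_le`), King's (3.93)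
log-rate `3t_N` (`1.25·10⁴ ↦ ≤ 1278`).  Nothing of [B5] is asserted; [folklore]. -/

section Chain

open scoped ComplexConjugate Matrix Topology
open Filter
open Literature.MathematicalPhysics.QuantumFieldTheory.Balaban1983to89.B5Prop11Plancherel
open Literature.MathematicalPhysics.QuantumFieldTheory.Balaban1983to89.B5QGQ199Rate
open Literature.MathematicalPhysics.QuantumFieldTheory.Balaban1983to89.Beta.LogCloseRate
open Literature.MathematicalPhysics.QuantumFieldTheory.Balaban1983to89.Beta.MonotoneScales

variable {N R : ℕ} [NeZero N] [NeZero R]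

/-- the certified floor serves both levels of one averaging step (the `hfl` binder of `LogCloseRate`). [folklore] -/
theorem Cfloor_floor₂ (hN : 1 ≤ N) (s : Fin d → ℝ) (hs : ∀ κ, |s κ| ≤ π) (ν₀ : Fin d)
    (hν₀ : s ν₀ ≠ 0) (κ : Fin d) : Cfloor d ≤ xIn N s κ ∧ Cfloor d ≤ xIn (R * N) s κ := by
  haveI : NeZero (R * N) := ⟨Nat.mul_ne_zero (NeZero.ne R) (NeZero.ne N)⟩
  have hRN : 1 ≤ R * N := Nat.one_le_iff_ne_zero.mpr (NeZero.ne (R * N))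
  exact ⟨Cfloor_le_xIn N hN s hs ν₀ hν₀ κ, Cfloor_le_xIn (R * N) hRN s hs ν₀ hν₀ κ⟩

omit [NeZero N] in
/-- the `p′`-uniform tolerance: `Δ₀(p′)·C_φ·N⁻²/C_floor ≤ 4d·C_φ/C_floor·N⁻²` (`Δ₀ ≤ 4d`). [folklore] -/
theorem tol_le_Cfloor (s : Fin d → ℝ) :
    Delta1r 0 s * (Cphi * ((N : ℝ) ^ 2)⁻¹) / Cfloor d ≤ 4 * d * Cphi / Cfloor d * ((N : ℝ) ^ 2)⁻¹ := by
  have hc := Cfloor_pos d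
  have hC := Cphi_pos
  rw [div_mul_eq_mul_div]
  refine div_le_div_of_nonneg_right ?_ hc.le
  have : 0 ≤ Cphi * ((N : ℝ) ^ 2)⁻¹ := by positivity
  nlinarith [Delta1r_le s]

/-- **THE BOX VARIABLE ACROSS ONE AVERAGING STEP, CERTIFIED FLOOR**: `y^{(N)} ≤ (1 + 4d·C_φ·C_floor⁻¹·N⁻²)·y^{(RN)}`
and conversely, all `N, R ≥ 1`, `p′ ≠ 0`, `κ` (twin of `LogCloseRate.xIn_relClose_gam0`). [folklore] -/
theorem xIn_relClose_Cfloor (hN : 1 ≤ N) (hR : 1 ≤ R) (s : Fin d → ℝ) (hs : ∀ κ, |s κ| ≤ π) (ν₀ : Fin d)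
    (hν₀ : s ν₀ ≠ 0) (κ : Fin d) :
    xIn N s κ ≤ (1 + 4 * d * Cphi / Cfloor d * ((N : ℝ) ^ 2)⁻¹) * xIn (R * N) s κ
      ∧ xIn (R * N) s κ ≤ (1 + 4 * d * Cphi / Cfloor d * ((N : ℝ) ^ 2)⁻¹) * xIn N s κ := by
  haveI : NeZero (R * N) := ⟨Nat.mul_ne_zero (NeZero.ne R) (NeZero.ne N)⟩
  have hc := Cfloor_pos d
  have hfl := Cfloor_floor₂ (R := R) hN s hs ν₀ hν₀
  obtain ⟨h1, h2⟩ := xIn_relClose_of_floor hN hR s hs ν₀ hν₀ hc hfl κ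
  have ht := tol_le_Cfloor (d := d) (N := N) s
  have hx0 : 0 ≤ xIn N s κ := le_trans hc.le (hfl κ).1
  have hx0' : 0 ≤ xIn (R * N) s κ := le_trans hc.le (hfl κ).2
  exact ⟨le_trans h1 (mul_le_mul_of_nonneg_right (by linarith) hx0'),
    le_trans h2 (mul_le_mul_of_nonneg_right (by linarith) hx0)⟩

/-- **`D_k` ACROSS ONE AVERAGING STEP IN THE LOEWNER ORDER, CERTIFIED FLOOR**:
`⟨w,D^{(N)}w⟩ ≤ (1 + 4d·C_φ·C_floor⁻¹·N⁻²)·⟨w,D^{(RN)}w⟩` and conversely (twin of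
`LogCloseRate.qform_DeltaKfib_relClose_gam0`; `d = 4`: relative constant `4173 ↦ ≤ 426`). [folklore] -/
theorem qform_DeltaKfib_relClose_Cfloor (hN : 1 ≤ N) (hR : 1 ≤ R) (s : Fin d → ℝ) (hs : ∀ κ, |s κ| ≤ π)
    (ν₀ : Fin d) (hν₀ : s ν₀ ≠ 0) (w : Fin d → ℂ) :
    (qform (DeltaKfib N s) w).re
        ≤ (1 + 4 * d * Cphi / Cfloor d * ((N : ℝ) ^ 2)⁻¹) * (qform (DeltaKfib (R * N) s) w).re
      ∧ (qform (DeltaKfib (R * N) s) w).re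
        ≤ (1 + 4 * d * Cphi / Cfloor d * ((N : ℝ) ^ 2)⁻¹) * (qform (DeltaKfib N s) w).re := by
  haveI : NeZero (R * N) := ⟨Nat.mul_ne_zero (NeZero.ne R) (NeZero.ne N)⟩
  have hRN : 1 ≤ R * N := Nat.one_le_iff_ne_zero.mpr (NeZero.ne (R * N))
  have hc := Cfloor_pos d
  have hfl := Cfloor_floor₂ (R := R) hN s hs ν₀ hν₀
  obtain ⟨hA, hB⟩ := qform_DeltaKfib_relClose hN hR s hs ν₀ hν₀ hc hfl w
  obtain ⟨q0, _, _⟩ := qform_DeltaKfib_bounds N hN s hs ν₀ hν₀ w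
  obtain ⟨q0', _, _⟩ := qform_DeltaKfib_bounds (R * N) hRN s hs ν₀ hν₀ w
  have ht := tol_le_Cfloor (d := d) (N := N) s
  exact ⟨le_trans hA (mul_le_mul_of_nonneg_right (by linarith) q0'),
    le_trans hB (mul_le_mul_of_nonneg_right (by linarith) q0)⟩

/-- **THE SANDWICH, CERTIFIED FLOOR**: `⟨w,D^{(N)}w⟩ ≤ ⟨w,D^{(RN)}w⟩ ≤ (1 + 4d·C_φ·C_floor⁻¹·N⁻²)·⟨w,D^{(N)}w⟩`
(twin of `MonotoneScales.qform_DeltaKfib_sandwich_gam0`). [folklore] -/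
theorem qform_DeltaKfib_sandwich_Cfloor (hN : 1 ≤ N) (hR : 1 ≤ R) (s : Fin d → ℝ) (hs : ∀ κ, |s κ| ≤ π)
    (ν₀ : Fin d) (hν₀ : s ν₀ ≠ 0) (w : Fin d → ℂ) :
    (qform (DeltaKfib N s) w).re ≤ (qform (DeltaKfib (R * N) s) w).re
      ∧ (qform (DeltaKfib (R * N) s) w).re
        ≤ (1 + 4 * d * Cphi / Cfloor d * ((N : ℝ) ^ 2)⁻¹) * (qform (DeltaKfib N s) w).re :=
  ⟨qform_DeltaKfib_mono hN hR s hs ν₀ hν₀ w, (qform_DeltaKfib_relClose_Cfloor hN hR s hs ν₀ hν₀ w).2⟩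

/-- **ENTRYWISE `η`-RATE OF `D_k`, CERTIFIED FLOOR**: `‖D^{(N)}_{μν} − D^{(RN)}_{μν}‖ ≤ Δ₀²·(2/C_floor²)·C_φ·N⁻²
≤ 16d²·(2/C_floor²)·C_φ·N⁻²` (twin of `LogCloseRate.DeltaKfib_rate_mult`, whose constant is `2γ₀⁻²`;
`d = 4`: `3.0·10⁷ ↦ ≤ 3.13·10⁵` for the `p′`-uniform constant). [folklore] -/
theorem DeltaKfib_rate_Cfloor (hN : 1 ≤ N) (hR : 1 ≤ R) (s : Fin d → ℝ) (hs : ∀ κ, |s κ| ≤ π) (ν₀ : Fin d)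
    (hν₀ : s ν₀ ≠ 0) (μ ν : Fin d) :
    ‖DeltaKfib N s μ ν - DeltaKfib (R * N) s μ ν‖
        ≤ Delta1r 0 s ^ 2 * (2 / Cfloor d ^ 2 * (Cphi * ((N : ℝ) ^ 2)⁻¹))
      ∧ Delta1r 0 s ^ 2 * (2 / Cfloor d ^ 2 * (Cphi * ((N : ℝ) ^ 2)⁻¹))
        ≤ 16 * d ^ 2 * (2 / Cfloor d ^ 2 * (Cphi * ((N : ℝ) ^ 2)⁻¹)) := by
  have hc := Cfloor_pos d
  have hC := Cphi_pos
  refine ⟨DeltaKfib_rate_of_floor hN hR s hs ν₀ hν₀ hc (Cfloor_floor₂ (R := R) hN s hs ν₀ hν₀) μ ν, ?_⟩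
  have hΔ0 : 0 ≤ Delta1r 0 s := (Delta1r_pos s hs ν₀ hν₀).le
  have hsq : Delta1r 0 s ^ 2 ≤ 16 * d ^ 2 := by nlinarith [Delta1r_le s]
  exact mul_le_mul_of_nonneg_right hsq (by positivity)

/-- form grade: `|⟨w,D^{(N)}w⟩ − ⟨w,D^{(RN)}w⟩| ≤ Δ₀²·C_φ·N⁻²/C_floor²·‖w‖²` (twin of
`LogCloseRate.qform_DeltaKfib_rate_of_floor` with the floor discharged). [folklore] -/
theorem qform_DeltaKfib_rate_Cfloor (hN : 1 ≤ N) (hR : 1 ≤ R) (s : Fin d → ℝ) (hs : ∀ κ, |s κ| ≤ π)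
    (ν₀ : Fin d) (hν₀ : s ν₀ ≠ 0) (w : Fin d → ℂ) :
    |(qform (DeltaKfib N s) w).re - (qform (DeltaKfib (R * N) s) w).re|
      ≤ Delta1r 0 s ^ 2 * (Cphi * ((N : ℝ) ^ 2)⁻¹) / Cfloor d ^ 2 * ∑ μ, ‖w μ‖ ^ 2 :=
  qform_DeltaKfib_rate_of_floor hN hR s hs ν₀ hν₀ (Cfloor_pos d) (Cfloor_floor₂ (R := R) hN s hs ν₀ hν₀) w

/-- **THE (1.66) WEIGHT ACROSS ONE AVERAGING STEP, CERTIFIED FLOOR**: `w^{(N)} ≤ (1+t_N)³·w^{(RN)}` and conversely,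
`t_N = 4d·C_φ·C_floor⁻¹·N⁻²` (twin of `LogCloseRate.w166_relClose`). [folklore] -/
theorem w166_relClose_Cfloor (hN : 1 ≤ N) (hR : 1 ≤ R) (μ ν : Fin d) (s : Fin d → ℝ) (hs : ∀ κ, |s κ| ≤ π)
    (ν₀ : Fin d) (hν₀ : s ν₀ ≠ 0) :
    w166 N μ ν s ≤ (1 + 4 * d * Cphi / Cfloor d * ((N : ℝ) ^ 2)⁻¹) ^ 3 * w166 (R * N) μ ν s
      ∧ w166 (R * N) μ ν s ≤ (1 + 4 * d * Cphi / Cfloor d * ((N : ℝ) ^ 2)⁻¹) ^ 3 * w166 N μ ν s := by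
  haveI : NeZero (R * N) := ⟨Nat.mul_ne_zero (NeZero.ne R) (NeZero.ne N)⟩
  have hRN : 1 ≤ R * N := Nat.one_le_iff_ne_zero.mpr (NeZero.ne (R * N))
  have hc := Cfloor_pos d
  have hC := Cphi_pos
  have ht : 0 ≤ 4 * d * Cphi / Cfloor d * ((N : ℝ) ^ 2)⁻¹ := by positivity
  exact w166_relClose_of_tol N (R * N) hN hRN μ ν s hs ν₀ hν₀ ht
    (fun κ => xIn_relClose_Cfloor hN hR s hs ν₀ hν₀ κ)

section Torus

variable (M : Fin d → ℕ) [hM : ∀ μ, NeZero (M μ)]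

/-- **THE U(1) EFFECTIVE ACTIONS ACROSS ONE AVERAGING STEP ARE `(1+t_N)³`-CLOSE, `t_N = 4d·C_φ·C_floor⁻¹·N⁻²`**, for
every unit torus, every vector field `B`, all `N, R ≥ 1` (twin of `LogCloseRate.formDk_relClose`; `d = 4`:
`t_N ≤ 426·N⁻²` against `4173·N⁻²`). [folklore] -/
theorem formDk_relClose_Cfloor (hN : 1 ≤ N) (hR : 1 ≤ R) (B : Tor M × Fin d → ℂ) :
    formDk N M B ≤ (1 + 4 * d * Cphi / Cfloor d * ((N : ℝ) ^ 2)⁻¹) ^ 3 * formDk (R * N) M B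
      ∧ formDk (R * N) M B ≤ (1 + 4 * d * Cphi / Cfloor d * ((N : ℝ) ^ 2)⁻¹) ^ 3 * formDk N M B := by
  haveI : NeZero (R * N) := ⟨Nat.mul_ne_zero (NeZero.ne R) (NeZero.ne N)⟩
  have hRN : 1 ≤ R * N := Nat.one_le_iff_ne_zero.mpr (NeZero.ne (R * N))
  have hc := Cfloor_pos d
  have hC := Cphi_pos
  have ht : 0 ≤ 4 * d * Cphi / Cfloor d * ((N : ℝ) ^ 2)⁻¹ := by positivity
  exact formDk_relClose_of_tol M N (R * N) hN hRN B ht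
    (fun p hp κ => by
      obtain ⟨ν₀, hν₀⟩ := Function.ne_iff.mp hp
      exact xIn_relClose_Cfloor hN hR (sOf M p) (abs_sOf_le M p) ν₀ hν₀ κ)

/-- the one-sided sandwich: `⟨B,Δ^{(N)}B⟩ ≤ ⟨B,Δ^{(RN)}B⟩ ≤ (1+t_N)³⟨B,Δ^{(N)}B⟩` with the certified-floor `t_N`
(twin of `MonotoneScales.formDk_sandwich`). [folklore] -/
theorem formDk_sandwich_Cfloor (hN : 1 ≤ N) (hR : 1 ≤ R) (B : Tor M × Fin d → ℂ) :
    formDk N M B ≤ formDk (R * N) M B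
      ∧ formDk (R * N) M B ≤ (1 + 4 * d * Cphi / Cfloor d * ((N : ℝ) ^ 2)⁻¹) ^ 3 * formDk N M B :=
  ⟨formDk_mono M hN hR B, (formDk_relClose_Cfloor M hN hR B).2⟩

/-- King's (3.92) shape relative to the form, certified floor:
`|⟨B,Δ^{(N)}B⟩ − ⟨B,Δ^{(RN)}B⟩| ≤ ((1+t_N)³ − 1)·⟨B,Δ^{(N)}B⟩`. [folklore] -/
theorem abs_formDk_sub_le_rel_Cfloor (hN : 1 ≤ N) (hR : 1 ≤ R) (B : Tor M × Fin d → ℂ) :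
    |formDk N M B - formDk (R * N) M B|
      ≤ ((1 + 4 * d * Cphi / Cfloor d * ((N : ℝ) ^ 2)⁻¹) ^ 3 - 1) * formDk N M B := by
  have hc := Cfloor_pos d
  have hC := Cphi_pos
  obtain ⟨h1, h2⟩ := formDk_relClose_Cfloor M hN hR B
  have ht : 0 ≤ 4 * d * Cphi / Cfloor d * ((N : ℝ) ^ 2)⁻¹ := by positivity
  have hK : (1 : ℝ) ≤ (1 + 4 * d * Cphi / Cfloor d * ((N : ℝ) ^ 2)⁻¹) ^ 3 := one_le_pow₀ (by linarith)
  exact abs_sub_le_of_relClose hK h1 h2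

/-- **KING'S (3.93) LOG FORM, CERTIFIED FLOOR**: `0 ≤ log⟨B,Δ^{(RN)}B⟩ − log⟨B,Δ^{(N)}B⟩ ≤ 3·log(1+t_N) ≤ 3t_N`,
`t_N = 4d·C_φ·C_floor⁻¹·N⁻²` (`d = 4`: `3t_N ≤ 1278·N⁻²` against `1.25·10⁴·N⁻²`; for `⟨B,Δ^{(N)}B⟩ = 0` both forms
vanish and Lean's `log 0 = 0` keeps the inequalities) — twin of `MonotoneScales.log_formDk_sub_bounds` /
`LogCloseRate.abs_log_formDk_sub_le`. [folklore] -/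
theorem log_formDk_sub_bounds_Cfloor (hN : 1 ≤ N) (hR : 1 ≤ R) (B : Tor M × Fin d → ℂ) :
    0 ≤ Real.log (formDk (R * N) M B) - Real.log (formDk N M B)
      ∧ Real.log (formDk (R * N) M B) - Real.log (formDk N M B)
          ≤ 3 * Real.log (1 + 4 * d * Cphi / Cfloor d * ((N : ℝ) ^ 2)⁻¹)
      ∧ 3 * Real.log (1 + 4 * d * Cphi / Cfloor d * ((N : ℝ) ^ 2)⁻¹)
          ≤ 3 * (4 * d * Cphi / Cfloor d * ((N : ℝ) ^ 2)⁻¹) := by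
  haveI : NeZero (R * N) := ⟨Nat.mul_ne_zero (NeZero.ne R) (NeZero.ne N)⟩
  have hRN : 1 ≤ R * N := Nat.one_le_iff_ne_zero.mpr (NeZero.ne (R * N))
  have hc := Cfloor_pos d
  have hC := Cphi_pos
  set t := 4 * d * Cphi / Cfloor d * ((N : ℝ) ^ 2)⁻¹ with htdef
  have ht : 0 ≤ t := by positivity
  have hlt : Real.log (1 + t) ≤ t := by
    have := Real.log_le_sub_one_of_pos (by linarith : 0 < 1 + t)
    linarith
  obtain ⟨h1, h2⟩ := formDk_sandwich_Cfloor M hN hR B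
  have f0 := formDk_nonneg M N hN B
  refine ⟨?_, ?_, by linarith⟩
  · rcases f0.eq_or_lt with hz | hpos
    · have hz' : formDk (R * N) M B = 0 := by
        have : formDk (R * N) M B ≤ 0 := by rw [← hz, mul_zero] at h2; exact h2
        linarith [formDk_nonneg M (R * N) hRN B]
      rw [← hz, hz', sub_self]
    · exact sub_nonneg.mpr (Real.log_le_log hpos h1)
  · rcases f0.eq_or_lt with hz | hpos
    · have hz' : formDk (R * N) M B = 0 := by
        have : formDk (R * N) M B ≤ 0 := by rw [← hz, mul_zero] at h2; exact h2
        linarith [formDk_nonneg M (R * N) hRN B]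
      rw [← hz, hz', sub_self]
      exact mul_nonneg (by norm_num) (Real.log_nonneg (by linarith))
    · have hpos' : 0 < formDk (R * N) M B := lt_of_lt_of_le hpos h1
      have hK : 0 < (1 + t) ^ 3 := by positivity
      have := Real.log_le_log hpos' h2
      rw [Real.log_mul hK.ne' hpos.ne', Real.log_pow, Nat.cast_ofNat] at this
      linarith

end Torus

/-! ### The `η → 0` limits along `N = L^k` with the certified floor -/

section ChainLimits

variable (L : ℕ) (hL : 2 ≤ L)
include hL

/-- **`D_k` HAS AN `η → 0` LIMIT, CERTIFIED FLOOR, WITH ITS RATES**: entrywise `p′`-uniformly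
`16d²·(2/C_floor²)·C_φ·L^{−2k}` (`d = 4`: `≤ 3.13·10⁵` against `3.0·10⁷`), in form grade `Δ₀²·C_φ/C_floor²·L^{−2k}·‖w‖²`,
and in Loewner form `⟨w,D^{(L^k)}w⟩ ≤ (1 + Δ₀C_φL^{−2k}/C_floor)·⟨w,D_∞w⟩` and conversely (`Δ₀ ≤ 4d`) — the
`LogCloseRate.DeltaKfib_limit_of_floor` socket with its floor discharged for every level at once. [folklore] -/
theorem DeltaKfib_limit_Cfloor (s : Fin d → ℝ) (hs : ∀ κ, |s κ| ≤ π) (ν₀ : Fin d) (hν₀ : s ν₀ ≠ 0) :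
    ∃ Dinf : Matrix (Fin d) (Fin d) ℂ,
      (∀ μ ν, Tendsto (fun k => DeltaKfib (L ^ k) s μ ν) atTop (𝓝 (Dinf μ ν)))
      ∧ (∀ k μ ν, ‖DeltaKfib (L ^ k) s μ ν - Dinf μ ν‖
          ≤ 16 * d ^ 2 * (2 / Cfloor d ^ 2 * Cphi) * ((L : ℝ) ^ k)⁻¹ ^ 2)
      ∧ (∀ k (w : Fin d → ℂ), |(qform (DeltaKfib (L ^ k) s) w).re - (qform Dinf w).re|
          ≤ Delta1r 0 s ^ 2 * Cphi / Cfloor d ^ 2 * ((L : ℝ) ^ k)⁻¹ ^ 2 * ∑ μ, ‖w μ‖ ^ 2)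
      ∧ ∀ k (w : Fin d → ℂ),
          (qform (DeltaKfib (L ^ k) s) w).re
              ≤ (1 + Delta1r 0 s * Cphi / Cfloor d * ((L : ℝ) ^ k)⁻¹ ^ 2) * (qform Dinf w).re
            ∧ (qform Dinf w).re
              ≤ (1 + Delta1r 0 s * Cphi / Cfloor d * ((L : ℝ) ^ k)⁻¹ ^ 2)
                  * (qform (DeltaKfib (L ^ k) s) w).re := by
  have hL0 : L ≠ 0 := by omega
  have hc := Cfloor_pos d
  have hC := Cphi_pos
  have hfl : ∀ k κ, Cfloor d ≤ xIn (L ^ k) s κ := fun k κ => by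
    haveI : NeZero (L ^ k) := ⟨pow_ne_zero k hL0⟩
    exact Cfloor_le_xIn (L ^ k) (Nat.one_le_pow k L (by omega)) s hs ν₀ hν₀ κ
  obtain ⟨Dinf, ht, hb, hf, hr⟩ := DeltaKfib_limit_of_floor L hL s hs ν₀ hν₀ hc hfl
  refine ⟨Dinf, ht, fun k μ ν => (hb k μ ν).trans ?_, hf, hr⟩
  have hΔ0 : 0 ≤ Delta1r 0 s := (Delta1r_pos s hs ν₀ hν₀).le
  have hsq : Delta1r 0 s ^ 2 ≤ 16 * d ^ 2 := by nlinarith [Delta1r_le s]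
  exact mul_le_mul_of_nonneg_right (mul_le_mul_of_nonneg_right hsq (by positivity)) (by positivity)

/-- **THE (1.66) WEIGHT'S LIMIT IN RELATIVE AND LOG FORM, CERTIFIED FLOOR**: `w^{(L^k)} ≤ (1+t_k)³·w_∞`,
`w_∞ ≤ (1+t_k)³·w^{(L^k)}`, `|log w^{(L^k)} − log w_∞| ≤ 3·log(1+t_k)`, `t_k = 4d·C_φ·C_floor⁻¹·L^{−2k}` (twin of
`LogCloseRate.w166_limit_rel`). [folklore] -/
theorem w166_limit_rel_Cfloor (μ ν : Fin d) (s : Fin d → ℝ) (hs : ∀ κ, |s κ| ≤ π) (ν₀ : Fin d)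
    (hν₀ : s ν₀ ≠ 0) :
    ∃ winf : ℝ, Tendsto (fun k => w166 (L ^ k) μ ν s) atTop (𝓝 winf) ∧ gam0 d ≤ winf
      ∧ ∀ k, w166 (L ^ k) μ ν s ≤ (1 + 4 * d * Cphi / Cfloor d * ((L : ℝ) ^ k)⁻¹ ^ 2) ^ 3 * winf
          ∧ winf ≤ (1 + 4 * d * Cphi / Cfloor d * ((L : ℝ) ^ k)⁻¹ ^ 2) ^ 3 * w166 (L ^ k) μ ν s
          ∧ |Real.log (w166 (L ^ k) μ ν s) - Real.log winf|
              ≤ 3 * Real.log (1 + 4 * d * Cphi / Cfloor d * ((L : ℝ) ^ k)⁻¹ ^ 2) := by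
  have hL0 : L ≠ 0 := by omega
  have hk : ∀ k, 1 ≤ L ^ k := fun k => Nat.one_le_pow k L (by omega)
  have hγ := gam0_pos d
  have hc := Cfloor_pos d
  have hC := Cphi_pos
  obtain ⟨winf, ht, -, hγw⟩ := B5ActionRate166.w166_limit L hL μ ν s hs ν₀ hν₀
  have rtail : ∀ k m, w166 (L ^ k) μ ν s
        ≤ (1 + 4 * d * Cphi / Cfloor d * ((L : ℝ) ^ k)⁻¹ ^ 2) ^ 3 * w166 (L ^ (k + m)) μ ν s
      ∧ w166 (L ^ (k + m)) μ ν s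
        ≤ (1 + 4 * d * Cphi / Cfloor d * ((L : ℝ) ^ k)⁻¹ ^ 2) ^ 3 * w166 (L ^ k) μ ν s := by
    intro k m
    haveI : NeZero (L ^ k) := ⟨pow_ne_zero k hL0⟩
    haveI : NeZero (L ^ m) := ⟨pow_ne_zero m hL0⟩
    have h := w166_relClose_Cfloor (N := L ^ k) (R := L ^ m) (hk k) (hk m) μ ν s hs ν₀ hν₀
    rw [pow_mul_pow_eq, cast_pow_sq_inv] at h
    exact h
  have hlim : ∀ k, Tendsto (fun m => w166 (L ^ (k + m)) μ ν s) atTop (𝓝 winf) := fun k => tendsto_shift ht k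
  refine ⟨winf, ht, hγw, fun k => ?_⟩
  have h1 : w166 (L ^ k) μ ν s ≤ (1 + 4 * d * Cphi / Cfloor d * ((L : ℝ) ^ k)⁻¹ ^ 2) ^ 3 * winf :=
    ge_of_tendsto' ((hlim k).const_mul _) fun m => (rtail k m).1
  have h2 : winf ≤ (1 + 4 * d * Cphi / Cfloor d * ((L : ℝ) ^ k)⁻¹ ^ 2) ^ 3 * w166 (L ^ k) μ ν s :=
    le_of_tendsto' (hlim k) fun m => (rtail k m).2
  refine ⟨h1, h2, ?_⟩
  haveI : NeZero (L ^ k) := ⟨pow_ne_zero k hL0⟩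
  have hwpos : 0 < w166 (L ^ k) μ ν s :=
    lt_of_lt_of_le (by positivity) (w166_bounds (L ^ k) (hk k) μ ν s hs ν₀ hν₀).1
  have hlog := abs_log_sub_le_of_relClose hwpos (lt_of_lt_of_le hγ hγw) h1 h2
  rwa [Real.log_pow, Nat.cast_ofNat] at hlog

variable (M : Fin d → ℕ) [hM : ∀ μ, NeZero (M μ)]

/-- **THE U(1) EFFECTIVE ACTION'S LIMIT IN RELATIVE FORM, CERTIFIED FLOOR**: `⟨B,Δ^{(L^k)}B⟩ ≤ (1+t_k)³F_∞(B)`,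
`F_∞(B) ≤ (1+t_k)³⟨B,Δ^{(L^k)}B⟩`, `|⟨B,Δ^{(L^k)}B⟩ − F_∞(B)| ≤ ((1+t_k)³ − 1)·⟨B,Δ^{(L^k)}B⟩` and, for
`⟨B,Δ^{(L^k)}B⟩ > 0`, `|log⟨B,Δ^{(L^k)}B⟩ − log F_∞(B)| ≤ 3log(1+t_k)`, `t_k = 4d·C_φ·C_floor⁻¹·L^{−2k}`
(`d = 4`: `3t_k ≤ 1278·L^{−2k}` against `1.25·10⁴·L^{−2k}`) — twin of `LogCloseRate.formDk_limit_rel`. [folklore] -/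
theorem formDk_limit_rel_Cfloor (B : Tor M × Fin d → ℂ) :
    ∃ Finf : ℝ, Tendsto (fun k => formDk (L ^ k) M B) atTop (𝓝 Finf) ∧ 0 ≤ Finf
      ∧ ∀ k, formDk (L ^ k) M B ≤ (1 + 4 * d * Cphi / Cfloor d * ((L : ℝ) ^ k)⁻¹ ^ 2) ^ 3 * Finf
          ∧ Finf ≤ (1 + 4 * d * Cphi / Cfloor d * ((L : ℝ) ^ k)⁻¹ ^ 2) ^ 3 * formDk (L ^ k) M B
          ∧ |formDk (L ^ k) M B - Finf|
              ≤ ((1 + 4 * d * Cphi / Cfloor d * ((L : ℝ) ^ k)⁻¹ ^ 2) ^ 3 - 1) * formDk (L ^ k) M B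
          ∧ (0 < formDk (L ^ k) M B → |Real.log (formDk (L ^ k) M B) - Real.log Finf|
              ≤ 3 * Real.log (1 + 4 * d * Cphi / Cfloor d * ((L : ℝ) ^ k)⁻¹ ^ 2)) := by
  have hL0 : L ≠ 0 := by omega
  have hk : ∀ k, 1 ≤ L ^ k := fun k => Nat.one_le_pow k L (by omega)
  have hc := Cfloor_pos d
  have hC := Cphi_pos
  obtain ⟨Finf, ht, -⟩ := B5ActionRate166.formDk_limit M L hL B
  have rtail : ∀ k m, formDk (L ^ k) M B
        ≤ (1 + 4 * d * Cphi / Cfloor d * ((L : ℝ) ^ k)⁻¹ ^ 2) ^ 3 * formDk (L ^ (k + m)) M B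
      ∧ formDk (L ^ (k + m)) M B
        ≤ (1 + 4 * d * Cphi / Cfloor d * ((L : ℝ) ^ k)⁻¹ ^ 2) ^ 3 * formDk (L ^ k) M B := by
    intro k m
    haveI : NeZero (L ^ k) := ⟨pow_ne_zero k hL0⟩
    haveI : NeZero (L ^ m) := ⟨pow_ne_zero m hL0⟩
    have h := formDk_relClose_Cfloor M (N := L ^ k) (R := L ^ m) (hk k) (hk m) B
    rw [pow_mul_pow_eq, cast_pow_sq_inv] at h
    exact h
  have hlim : ∀ k, Tendsto (fun m => formDk (L ^ (k + m)) M B) atTop (𝓝 Finf) := fun k => tendsto_shift ht k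
  have hF0 : 0 ≤ Finf := ge_of_tendsto' ht fun k => by
    haveI : NeZero (L ^ k) := ⟨pow_ne_zero k hL0⟩
    exact formDk_nonneg M (L ^ k) (hk k) B
  refine ⟨Finf, ht, hF0, fun k => ?_⟩
  set K := (1 + 4 * d * Cphi / Cfloor d * ((L : ℝ) ^ k)⁻¹ ^ 2) ^ 3 with hK
  have hK1 : 1 ≤ K := one_le_pow₀ (by simp only [le_add_iff_nonneg_right]; positivity)
  have h1 : formDk (L ^ k) M B ≤ K * Finf := ge_of_tendsto' ((hlim k).const_mul _) fun m => (rtail k m).1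
  have h2 : Finf ≤ K * formDk (L ^ k) M B := le_of_tendsto' (hlim k) fun m => (rtail k m).2
  refine ⟨h1, h2, abs_sub_le_of_relClose hK1 h1 h2, fun hpos => ?_⟩
  have hFpos : 0 < Finf := by
    haveI : NeZero (L ^ k) := ⟨pow_ne_zero k hL0⟩
    have : 0 < K := by positivity
    nlinarith [h1]
  have hlog := abs_log_sub_le_of_relClose hpos hFpos h1 h2
  rwa [hK, Real.log_pow, Nat.cast_ofNat] at hlog

end ChainLimits

/-! ### The numbers at `d = 4` -/

/-- `C_φ = π²/12 + 1/3 ≤ 1.1559`. [folklore] -/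
theorem Cphi_le : Cphi ≤ 1.1559 := by
  unfold Cphi
  have h := Real.pi_lt_d4
  have h0 := Real.pi_pos
  nlinarith

/-- `d = 4`: the relative constant `4d·C_φ/C_floor(4) ≤ 426` (tree floor: `4d·C_φ/γ₀ = 4173`). [folklore] -/
theorem relConst_four_le : 4 * ((4 : ℕ) : ℝ) * Cphi / Cfloor 4 ≤ 426 := by
  have h1 := Cfloor_four_ge
  have h2 := Cphi_le
  have hc := Cfloor_pos 4
  rw [div_le_iff₀ hc]
  push_cast
  nlinarith

/-- `d = 4`: King's (3.93) log-rate constant `3·4d·C_φ/C_floor(4) ≤ 1278` (tree floor: `1.25·10⁴`). [folklore] -/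
theorem logConst_four_le : 3 * (4 * ((4 : ℕ) : ℝ) * Cphi / Cfloor 4) ≤ 1278 := by
  have := relConst_four_le; linarith

/-- `d = 4`: the `p′`-uniform entry constant of `D_k`, `16d²·(2/C_floor(4)²)·C_φ ≤ 3.13·10⁵` (tree floor:
`16d²·2γ₀⁻²·C_φ = 3.0·10⁷`). [folklore] -/
theorem entryConst_four_le : 16 * ((4 : ℕ) : ℝ) ^ 2 * (2 / Cfloor 4 ^ 2 * Cphi) ≤ 313000 := by
  have h1 := Cfloor_four_ge
  have h2 := Cphi_le
  have hC := Cphi_pos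
  have hc := Cfloor_pos 4
  have hsq : (0.0435 : ℝ) ^ 2 ≤ Cfloor 4 ^ 2 := pow_le_pow_left₀ (by norm_num) h1 2
  have e : 16 * ((4 : ℕ) : ℝ) ^ 2 * (2 / Cfloor 4 ^ 2 * Cphi) = 512 * Cphi / Cfloor 4 ^ 2 := by
    push_cast; field_simp; ring
  rw [e, div_le_iff₀ (by positivity)]
  nlinarith

end Chain

end Literature.MathematicalPhysics.QuantumFieldTheory.Balaban1983to89.Beta.NearAliasFloor

end
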